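import Mathlib
import Literature.MathematicalPhysics.QuantumFieldTheory.Balaban1983to89.B13ScaleTransfer

/-!
# `Balaban1983to89.TreeLength` — [Balaban1987RG1] p. 257, the linear size d_j(X) of a localization domain,
FORMALISED (continuum polygonal graphs in a union of unit cubes, sup metric), with kernel proofs of the tree-length
lemmas that the sibling module `…B13ScaleTransfer` enters as quoted leaves, of [Balaban1988RG2Cluster] p. 18 (2.27),
and of the upper half of (2.30); revision v2 (Parts 5–7): the Steiner length ℓ̃ of [Dimock2013BalabanII] App. E, a
linear volume bound |Y| ≤ 2^d(4ℓ̃(Y) + 1) (repaired lower half of (2.30)), the remaining leaves, and the scale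
transfer `ScaleTransfer d L treeLen (Acoef d) (Bcoef d)` of `…B13ScaleTransfer` with NO leaf hypotheses

CITATION HEADER (lean-in-tree rule 2026-08-18).  Sources under audit: T. Bałaban, *Renormalization group approach to
lattice gauge field theories. I. Generation of effective actions in a small field approximation and a coupling
constant renormalization in four dimensions*, Commun. Math. Phys. **109**, 249–301 (1987) [Balaban1987RG1] (cell
paper B12; p. 257 = PDF p. 9 of the held render `1987-cmp109-rg-I-small-field`), and *Renormalization group approach
to lattice gauge field theories. II. Cluster expansions*, Commun. Math. Phys. **116**, 1–22 (1988)
[Balaban1988RG2Cluster] (cell paper B13; held `paper:balaban1988-cmp116-rg-ii-cluster`, journal page = PDF page;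
p. 18).  Quotations below were read from the page renders `HOME/b2b-balaban-ref1/pages/1987-cmp109-rg-I-small-field/…-p009`
and `…/1988-cmp116-rg-II-cluster/…-p018`.  Published inputs whose MECHANISM is re-proved here for the object defined
here (nothing of them is assumed): J. Dimock, *The renormalization group according to Balaban. I. Small fields*, Rev.
Math. Phys. **25** (2013) 1330010 [Dimock2013], §3 proof of Lemma 10 (reblocking, first sentence: *"a minimal tree on
the M blocks in X is also a tree on the LM blocks in Y and so M d_M(X) ≥ LM d_{LM}(Y)"*) and §4 Lemma 20 (*"M d_M(Y)
≤ M|Y − X|_M + M d_M(X)"*); *II. Large fields*, J. Math. Phys. **54** (2013) 092301 [Dimock2013BalabanII], Appendix E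
(the metric convention, verbatim: *"(We use the metric |x − y| = sup_μ |x_μ − y_μ|)"*).  Satellite of
`…Balaban1983to89.B13ScaleTransfer` (unit pv11), imported for the ℤ^d index model (`Pt`, `Adj`, `FaceConnected`,
`coarse`, `closureIdx`) and for the leaf `Prop`s `CoarseningLeaf`, `AdjoinLeaf` DISCHARGED below for the tree length
defined here, and of `…Balaban1983to89.B13` (units r2 / b13: `B13.prod_bound_228`); nothing existing is modified.
Cell records: DIVERGENCE F5 (tree geometry hitherto abstract in the tree), D-T2 (metric unnamed in print), GAPS.md
C-B13-04 ((2.27)), G-B13-07 ((2.30)); TEMPLATE.md v4 §15.2 (*"NOT in the tree and not attempted: any statement about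
the continuum tree length d_M itself"*); unit `b2b-balaban-pv22` (surge node prover #22).

WHAT THE PAPERS PRINT.  [Balaban1987RG1] p. 257, verbatim: *"Thus every localization domain X is a union of continuous
space cubes from π_j. Consider a class of tree graphs contained in X and intersecting all the cubes in X. A length of
a shortest graph in this class, divided by M, is the linear size of X, and is denoted by d_j(X). Thus we rescale the
space, so that cubes from π_j become unit cubes, and we take the distance in this scale. Let us stress the fact that
we consider graphs in the continuous space. For a given X usually there are many of these shortest tree graphs. It
is easy to see that there are also the shortest tree graphs formed by edges of cubes in X, hence an equivalent
definition can be formulated, based on such graphs only."*  [Balaban1988RG2Cluster] p. 18, verbatim: *"Because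
⋃_{Y∈𝐃} Y = Y₀ and Y₀ is a connected domain, hence the definition of d_k(Y) implies the inequality
Σ_{Y∈𝐃} (d_k(Y) + 5) ≧ d_k(Y₀) + 5. (2.27)"*, and *"In connection with this notice the following useful inequality
(3·2³)⁻¹M⁻⁴|Y| ≦ d_k(Y) ≦ M⁻⁴|Y| − 1 (2.30) holding for localization domains Y ∈ 𝐃_k."*  (M⁻⁴|Y| = the number
of cubes of π_k in Y, d = 4; below `Y.card` in the index model.)

WHAT IS REPRODUCED HERE (kernel-checked).  Part 1 — the continuum over the index model of `…B13ScaleTransfer`: the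
closed unit cube `cube x = [x, x + 1]^d ⊂ ℝ^d` of index x ∈ ℤ^d (ℝ^d = `Fin d → ℝ` with Mathlib's sup metric),
finite POLYGONAL GRAPHS (finite lists of segments: `carrier`, `len`), admissibility for X (`Admissible X T`: carrier
connected, contained in the union of the cubes of X, meeting every cube of X) and `treeLen X` = the infimum of the
lengths of the admissible graphs (= d_j(X) in the rescaled picture, up to the conventions (i)–(ii) below).  Part 2 —
PROVED: `treeLen_nonneg`; `treeLen_singleton` (= 0); existence of admissible graphs for every localization domain and
the UPPER HALF of (2.30), `treeLen_le_card_sub_one` (d_k(Y) ≤ |Y|_cubes − 1); the adjoining inequality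
`treeLen_le_card_sdiff_add` (d(Y) ≤ |Y ∖ X| + d(X) for localization domains X ⊆ Y — the statement of [Dimock2013]
Lemma 20, by its mechanism: a frontier cube and one segment of length ≤ 1 per adjoined cube), i.e. the leaf
`AdjoinLeaf d treeLen` of `…B13ScaleTransfer` as a THEOREM (`adjoinLeaf_treeLen`).  Part 3 — PROVED: exact coarsening
`mul_treeLen_closureIdx_le` (L·d_{k+1}(X̄) ≤ d_k(X): the homothety p ↦ p/L maps an admissible graph for X onto one for
the family X̄ of π_{k+1}-cubes met by X — [Dimock2013] proof of Lemma 10, first sentence), i.e. the leaf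
`CoarseningLeaf d L treeLen` as a THEOREM (`coarseningLeaf_treeLen`).  Part 4 — PROVED: (2.27) in the sharper form
`treeLen_biUnion_add_two_le` (d_k(Y₀) + 2 ≤ Σ_{Y∈𝐃}(d_k(Y) + 2) for a non-empty finite family 𝐃 of localization
domains with connected union Y₀: near-optimal graphs of the members are glued one member at a time through a common
cube (cost ≤ 1) or through a pair of adjacent cubes (cost ≤ 2)), whence the printed constant 5 (`ineq227_treeLen`) and
the instantiation of the abstract length `d` of `B13.prod_bound_228` (unit b13, (2.27) ⇒ (2.28)) at d := treeLen
(`prod_bound_228_treeLen`).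

CONVENTIONS / WHAT IS *NOT* REPRODUCED OR ASSERTED.  (i) METRIC: [Balaban1987RG1] names no metric for the length of a
graph (cell DIVERGENCE D-T2); this module uses the sup metric of [Dimock2013BalabanII] App. E (Mathlib's metric on
`Fin d → ℝ`).  The joining segments used in the proofs are axis-parallel or lie in a single cube, so the same
arguments give the same inequalities for the ℓ¹/ℓ² lengths with the in-cube joining cost 1 replaced by the ℓ¹/ℓ²
diameter of the unit cube; only the sup-metric statements are kernel-checked.  (ii) TREES vs CONNECTED GRAPHS: the
infimum is taken over connected finite unions of segments rather than over tree graphs (cell DIVERGENCE D-pv22.1); a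
tree graph is such a union, so `treeLen` ≤ the printed d_j; the reverse inequality (pruning a connected polygonal graph
to a tree) is NOT proved or used.  (iii) The infimum is not shown to be attained (p. 257 *"a shortest graph"*), and
the "equivalent definition" by edge graphs (p. 257, *"It is easy to see …"*) is NOT reproduced.  (iv) NOT here: the
lower half of (2.30) AS PRINTED (false for |Y| = M⁴, cell GAPS.md G-B13-07 — its repaired additive form is Part 7 of
revision v2), (2.36) as printed (G-B13-09 — v2 proves the substitute `ScaleTransfer` of `…B13ScaleTransfer` for
`treeLen`, constants A_d, B_d, not the printed "3", cell DIVERGENCE D-pv11.1), anything about the series.  Junk value: for X empty or not connected the admissible class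
is empty and `treeLen X = sInf ∅ = 0`; every statement below carries the hypotheses `Nonempty` / `FaceConnected` where
they matter.  Value = typed skeleton + kernel-checked bookkeeping (leaf discharge), NOT summit progress.

REVISION v2 (same unit; Parts 1–4 unchanged, byte-identical).  Additional published input whose MECHANISM is
re-proved for the objects defined here: [Dimock2013BalabanII] Appendix E, verbatim: *"In the following ''tree'' means
continuum tree. … M ℓ̃_M(Y) is the length of a minimal tree whose vertices are one point from each block in Y and
possibly other points. … If Y is connected then ℓ̃_M(Y) differs slightly from d_M(Y) defined in part I, since the
latter requires a minimal tree to lie in Y. But we do have ℓ̃_M(Y) ≤ d_M(Y)."* and Lemma E.1, verbatim: *"(1) ℓ_M(Y)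
≤ 2ℓ̃_M(Y) … (3) |Y|_M ≤ 4(2^d + 1)(ℓ_M(Y) + 1)"*, with, in the proof of (3), *"since at most 2^d blocks be mutually
touching"* (read from the held TeX source of arXiv:1212.5562, cell inputs D2).  Part 5 — the length `lenIn B T` of a
graph inside a closed region B (Lebesgue measure of the segment parameters; Mathlib's `volume` on ℝ) and its
additivity over pairwise disjoint closed regions (`sum_lenIn_le_len`).  Part 6 — PROVED, the CAPTURE LEMMA
`le_lenIn_closedBall`: a connected graph through the centre p of a closed sup-ball of radius ρ that reaches distance
≥ ρ from p has length ≥ ρ inside the ball (exit lemma `exists_far_mem_component` by maximality of the connected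
component of p in T ∩ B̄; then a coordinate projection of that component is an interval of length ≥ ρ covered by the
projected pieces, `volume_projU_le`).  Part 7 — the Steiner-admissible graphs (`SAdmissible`: connected, meeting every
cube of Y, not confined to Y) and `steinerLen Y` (ℓ̃, up to conventions (i)–(ii): ≤ the printed ℓ̃_M); PROVED:
`steinerLen_le_treeLen` (ℓ̃ ≤ d, the App. E preamble claim), the LINEAR VOLUME BOUND `card_le_steinerLen`
(|Y| ≤ 2^d(4ℓ̃(Y) + 1) for every non-empty Y — the analogue of Lemma E.1 (3) with a smaller constant, by a maximal
2ρ-separated net of witness points, ρ ↑ 1/4, and the capture lemma instead of the printed path argument), whence the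
REPAIRED LOWER HALF of (2.30) `card_le_treeLen` (|Y| ≤ 2^d(4d_k(Y) + 1); d = 4: |Y| ≤ 64 d_k(Y) + 16), the leaves
`SteinerLeaf d (2ℓ̃) ℓ̃`, `VolumeLeaf d (2ℓ̃)`, `InsideLeaf d ℓ̃ treeLen` of `…B13ScaleTransfer` as THEOREMS (the pair
(ℓ, ℓ̃) := (2ℓ̃, ℓ̃): Dimock's second length ℓ_M is not formalised), and the MAIN COROLLARY `scaleTransfer_treeLen :
ScaleTransfer d L treeLen (Acoef d) (Bcoef d)` — unit pv11's five-leaf scale transfer (cell GAPS.md G-B13-09 /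
C-pv11-1) with every leaf discharged — plus the sharper direct chain `scaleTransfer_treeLen_sharp` (constants
1 + 4·2^d(3^d − 1), 2^d(3^d − 1); d = 4: 5121, 1280, `scaleTransfer_treeLen_four`).  NOT asserted in v2: equality of
`steinerLen` with the printed ℓ̃_M (trees vs connected polygonal graphs, as in (ii)); Lemma E.1 (1)–(2) for Dimock's
ℓ_M, ℓ′_M; attainment of the infima.  Value unchanged: kernel-checked bookkeeping (leaf discharge), NOT summit progress.
-/

namespace Literature.MathematicalPhysics.QuantumFieldTheory.Balaban1983to89.TreeLength

noncomputable section

open Literature.MathematicalPhysics.QuantumFieldTheory.Balaban1983to89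
open Literature.MathematicalPhysics.QuantumFieldTheory.Balaban1983to89.B13ScaleTransfer

variable {d : ℕ}

/-! ## Part 1. The continuum: unit cubes of index x ∈ ℤ^d, polygonal graphs, admissibility, `treeLen` -/

/-- A point of the continuum ℝ^d ([Balaban1987RG1] p. 257: *"the continuous space T scaled properly"*), carrying
Mathlib's sup metric `dist p q = sup_μ |p_μ − q_μ|`, which is the convention of [Dimock2013BalabanII] App. E,
verbatim: *"(We use the metric |x − y| = sup_μ |x_μ − y_μ|)"*. [cite: Dimock2013BalabanII, App. E (metric convention)] -/
abbrev RPt (d : ℕ) := Fin d → ℝ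

/-- A segment of a polygonal graph, recorded by its two endpoints. [folklore] -/
abbrev Seg (d : ℕ) := RPt d × RPt d

/-- The lower corner (x_μ)_μ ∈ ℝ^d of the cube of index x ∈ ℤ^d. [folklore] -/
def corner (x : Pt d) : RPt d := fun i => (x i : ℝ)

/-- The closed unit cube [x, x + 1]^d of index x ∈ ℤ^d — [Balaban1987RG1] p. 257, verbatim: *"We decompose the space
T into the lattice of closed cubes of a size M … we rescale the space, so that cubes from π_j become unit cubes"*. [cite: Balaban1987RG1, p.257 (localization domains)] -/
def cube (x : Pt d) : Set (RPt d) := Set.Icc (corner x) (corner x + 1)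

/-- Membership in the cube of index x, coordinatewise: x_μ ≤ p_μ ≤ x_μ + 1. [folklore] -/
theorem mem_cube {x : Pt d} {p : RPt d} : p ∈ cube x ↔ ∀ i, (x i : ℝ) ≤ p i ∧ p i ≤ (x i : ℝ) + 1 := by
  simp only [cube, Set.mem_Icc, Pi.le_def, corner, Pi.add_apply, Pi.one_apply, forall_and]

/-- The corner of a cube belongs to the cube. [folklore] -/
theorem corner_mem_cube (x : Pt d) : corner x ∈ cube x :=
  mem_cube.2 fun i => ⟨le_rfl, by simp [corner]⟩

/-- Cubes are convex. [folklore] -/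
theorem convex_cube (x : Pt d) : Convex ℝ (cube x) := convex_Icc _ _

/-- Two points of one unit cube are at sup-distance at most 1. [folklore] -/
theorem dist_le_one_of_mem_cube {x : Pt d} {p q : RPt d} (hp : p ∈ cube x) (hq : q ∈ cube x) : dist p q ≤ 1 := by
  rw [dist_pi_le_iff zero_le_one]
  intro i
  obtain ⟨h1, h2⟩ := mem_cube.1 hp i
  obtain ⟨h3, h4⟩ := mem_cube.1 hq i
  rw [Real.dist_eq]
  exact abs_sub_le_iff.2 ⟨by linarith, by linarith⟩

/-- The union of the cubes of an index set X ([Balaban1987RG1] p. 257: *"every localization domain X is a union of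
continuous space cubes from π_j"*). [cite: Balaban1987RG1, p.257 (localization domains)] -/
def cubes (X : Finset (Pt d)) : Set (RPt d) := ⋃ x ∈ X, cube x

/-- Membership in the union of the cubes of X. [folklore] -/
theorem mem_cubes {X : Finset (Pt d)} {p : RPt d} : p ∈ cubes X ↔ ∃ x ∈ X, p ∈ cube x := by
  simp [cubes]

/-- A cube of X lies in the union of the cubes of X. [folklore] -/
theorem cube_subset_cubes {X : Finset (Pt d)} {x : Pt d} (hx : x ∈ X) : cube x ⊆ cubes X :=
  fun _ hp => mem_cubes.2 ⟨x, hx, hp⟩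

/-- The union of cubes is monotone in the index set. [folklore] -/
theorem cubes_mono {X Y : Finset (Pt d)} (h : X ⊆ Y) : cubes X ⊆ cubes Y := by
  intro p hp
  obtain ⟨x, hx, hpx⟩ := mem_cubes.1 hp
  exact mem_cubes.2 ⟨x, h hx, hpx⟩

/-- The point set of a polygonal graph, i.e. of a finite list of segments: the union of its closed segments
([Balaban1987RG1] p. 257: *"we consider graphs in the continuous space"*). [cite: Balaban1987RG1, p.257 (linear size d_j)] -/
def carrier : List (Seg d) → Set (RPt d)
  | [] => ∅
  | s :: T => segment ℝ s.1 s.2 ∪ carrier T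

/-- The length of a polygonal graph: the sum of the sup-metric lengths of its segments ([Balaban1987RG1] p. 257:
*"A length of a … graph"*; convention (i) of the module header). [cite: Balaban1987RG1, p.257 (linear size d_j)] -/
def len : List (Seg d) → ℝ
  | [] => 0
  | s :: T => dist s.1 s.2 + len T

/-- The empty graph has empty carrier. [folklore] -/
@[simp] theorem carrier_nil : carrier ([] : List (Seg d)) = ∅ := rfl

/-- Carrier of a graph with one more segment. [folklore] -/
@[simp] theorem carrier_cons (s : Seg d) (T : List (Seg d)) :
    carrier (s :: T) = segment ℝ s.1 s.2 ∪ carrier T := rfl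

/-- The empty graph has length 0. [folklore] -/
@[simp] theorem len_nil : len ([] : List (Seg d)) = 0 := rfl

/-- Length of a graph with one more segment. [folklore] -/
@[simp] theorem len_cons (s : Seg d) (T : List (Seg d)) : len (s :: T) = dist s.1 s.2 + len T := rfl

/-- Carrier of a concatenation of two graphs = union of the carriers. [folklore] -/
theorem carrier_append (T T' : List (Seg d)) : carrier (T ++ T') = carrier T ∪ carrier T' := by
  induction T with
  | nil => simp
  | cons s T ih => simp [ih, Set.union_assoc]

/-- Length of a concatenation of two graphs = sum of the lengths. [folklore] -/
theorem len_append (T T' : List (Seg d)) : len (T ++ T') = len T + len T' := by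
  induction T with
  | nil => simp
  | cons s T ih => simp [ih, add_assoc]

/-- Lengths are non-negative. [folklore] -/
theorem len_nonneg (T : List (Seg d)) : 0 ≤ len T := by
  induction T with
  | nil => simp
  | cons s T ih => rw [len_cons]; positivity

/-- ADMISSIBLE GRAPHS for X — [Balaban1987RG1] p. 257, verbatim: *"Consider a class of tree graphs contained in X and
intersecting all the cubes in X"*: the carrier is connected (hence non-empty), contained in the union of the cubes of
X, and meets every cube of X.  Convention (ii) of the module header: connected finite unions of segments in place of
tree graphs. [cite: Balaban1987RG1, p.257 (linear size d_j)] -/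
structure Admissible (X : Finset (Pt d)) (T : List (Seg d)) : Prop where
  /-- the graph is connected -/
  connected : IsConnected (carrier T)
  /-- the graph is contained in X -/
  subset : carrier T ⊆ cubes X
  /-- the graph intersects all the cubes in X -/
  meets : ∀ x ∈ X, (carrier T ∩ cube x).Nonempty

/-- The set of lengths of the admissible graphs for X. [cite: Balaban1987RG1, p.257 (linear size d_j)] -/
def lengths (X : Finset (Pt d)) : Set ℝ := {ℓ | ∃ T, Admissible X T ∧ len T = ℓ}

/-- THE LINEAR SIZE d_j(X) — [Balaban1987RG1] p. 257, verbatim: *"A length of a shortest graph in this class, divided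
by M, is the linear size of X, and is denoted by d_j(X). Thus we rescale the space, so that cubes from π_j become unit
cubes, and we take the distance in this scale."* — as the infimum of the lengths of the admissible graphs in the
rescaled picture (unit cubes, so no division by M).  Junk value `sInf ∅ = 0` when X has no admissible graph (X empty
or not connected); conventions (i)–(iii) of the module header. [cite: Balaban1987RG1, p.257 (linear size d_j)] -/
def treeLen (X : Finset (Pt d)) : ℝ := sInf (lengths X)

/-! ## Part 2. Basic properties; adjoining cubes ([Dimock2013] Lemma 20 mechanism); the upper half of (2.30) -/

/-- Members of `lengths X` are non-negative. [folklore] -/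
theorem lengths_nonneg {X : Finset (Pt d)} {ℓ : ℝ} (h : ℓ ∈ lengths X) : 0 ≤ ℓ := by
  obtain ⟨T, -, rfl⟩ := h
  exact len_nonneg T

/-- `lengths X` is bounded below (by 0). [folklore] -/
theorem bddBelow_lengths (X : Finset (Pt d)) : BddBelow (lengths X) :=
  ⟨0, fun _ h => lengths_nonneg h⟩

/-- d_j(X) ≥ 0. [cite: Balaban1987RG1, p.257 (linear size d_j)] -/
theorem treeLen_nonneg (X : Finset (Pt d)) : 0 ≤ treeLen X :=
  Real.sInf_nonneg fun _ h => lengths_nonneg h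

/-- d_j(X) is at most the length of any admissible graph for X. [cite: Balaban1987RG1, p.257 (linear size d_j)] -/
theorem treeLen_le_len {X : Finset (Pt d)} {T : List (Seg d)} (h : Admissible X T) : treeLen X ≤ len T :=
  csInf_le (bddBelow_lengths X) ⟨T, h, rfl⟩

/-- A lower bound of the lengths of all admissible graphs is a lower bound of d_j(X), provided the class is
non-empty. [folklore] -/
theorem le_treeLen {X : Finset (Pt d)} {a : ℝ} (hne : ∃ T, Admissible X T)
    (h : ∀ T, Admissible X T → a ≤ len T) : a ≤ treeLen X := by
  obtain ⟨T₀, hT₀⟩ := hne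
  refine le_csInf ⟨len T₀, T₀, hT₀, rfl⟩ ?_
  rintro _ ⟨T, hT, rfl⟩
  exact h T hT

/-- Near-optimal admissible graphs: for every ε > 0 there is one of length < d_j(X) + ε (the infimum need not be
attained; convention (iii)). [folklore] -/
theorem exists_admissible_len_lt {X : Finset (Pt d)} (hne : ∃ T, Admissible X T) {ε : ℝ} (hε : 0 < ε) :
    ∃ T, Admissible X T ∧ len T < treeLen X + ε := by
  obtain ⟨T₀, hT₀⟩ := hne
  obtain ⟨ℓ, ⟨T, hT, rfl⟩, hlt⟩ :=
    exists_lt_of_csInf_lt (s := lengths X) ⟨len T₀, T₀, hT₀, rfl⟩ (lt_add_of_pos_right _ hε)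
  exact ⟨T, hT, hlt⟩

/-- An index set with an admissible graph is non-empty. [folklore] -/
theorem Admissible.finset_nonempty {X : Finset (Pt d)} {T : List (Seg d)} (h : Admissible X T) : X.Nonempty := by
  obtain ⟨p, hp⟩ := h.connected.nonempty
  obtain ⟨x, hx, -⟩ := mem_cubes.1 (h.subset hp)
  exact ⟨x, hx⟩

/-- The one-point graph at the corner of a cube is admissible for that cube (length 0). [folklore] -/
theorem admissible_singleton (x : Pt d) : Admissible ({x} : Finset (Pt d)) [(corner x, corner x)] := by
  refine ⟨?_, ?_, ?_⟩
  · simp only [carrier_cons, carrier_nil, Set.union_empty, segment_same]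
    exact isConnected_singleton
  · simp only [carrier_cons, carrier_nil, Set.union_empty, segment_same, Set.singleton_subset_iff]
    exact mem_cubes.2 ⟨x, Finset.mem_singleton_self x, corner_mem_cube x⟩
  · intro y hy
    rw [Finset.mem_singleton] at hy
    subst hy
    exact ⟨corner y, by simp, corner_mem_cube y⟩

/-- Wall point: if the cubes a and c have a common wall and p ∈ cube a, then moving p along the coordinate axis normal
to the wall reaches a point q of the common wall (q ∈ cube a ∩ cube c) at sup-distance ≤ 1 — the segment used in the
proof of [Dimock2013] Lemma 20, verbatim: *"Now extend the tree τ by taking a line from x′_i to the translated point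
x_i in □_i. Then extend it to all of (Y−X)_i by taking lines across two dimensional faces joining translates of
x_i."* (there d = 3, so a "two dimensional face" is a common wall in the sense of [Balaban1987RG1] p. 257; here the
segment stops ON the wall instead of at the translated point, so its cost is ≤ 1 rather than = 1). [cite: Dimock2013, §4 Lemma 20 (proof)] -/
theorem exists_wall_point {a c : Pt d} (hac : Adj a c) {p : RPt d} (hp : p ∈ cube a) :
    ∃ q : RPt d, q ∈ cube a ∧ q ∈ cube c ∧ dist p q ≤ 1 := by
  have hp' := mem_cube.1 hp
  obtain ⟨i, h | h⟩ := hac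
  · -- c = a + e_i : go to the wall {p_i = a_i + 1}
    have hci : c i = a i + 1 := by rw [h, Function.update_self]
    have hcj : ∀ j, j ≠ i → c j = a j := fun j hj => by rw [h, Function.update_of_ne hj]
    refine ⟨Function.update p i ((a i : ℝ) + 1), ?_, ?_, ?_⟩
    · rw [mem_cube]
      intro j
      by_cases hj : j = i
      · rw [hj, Function.update_self]
        constructor <;> linarith
      · rw [Function.update_of_ne hj]
        exact hp' j
    · rw [mem_cube]
      intro j
      by_cases hj : j = i
      · rw [hj, Function.update_self, hci]
        push_cast
        constructor <;> linarith
      · rw [Function.update_of_ne hj, hcj j hj]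
        exact hp' j
    · rw [dist_pi_le_iff zero_le_one]
      intro j
      by_cases hj : j = i
      · rw [hj, Function.update_self, Real.dist_eq]
        obtain ⟨h1, h2⟩ := hp' i
        exact abs_sub_le_iff.2 ⟨by linarith, by linarith⟩
      · rw [Function.update_of_ne hj, dist_self]
        exact zero_le_one
  · -- a = c + e_i : go to the wall {p_i = a_i}
    have hai : a i = c i + 1 := by rw [h, Function.update_self]
    have haj : ∀ j, j ≠ i → a j = c j := fun j hj => by rw [h, Function.update_of_ne hj]
    refine ⟨Function.update p i (a i : ℝ), ?_, ?_, ?_⟩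
    · rw [mem_cube]
      intro j
      by_cases hj : j = i
      · rw [hj, Function.update_self]
        constructor <;> linarith
      · rw [Function.update_of_ne hj]
        exact hp' j
    · rw [mem_cube]
      intro j
      by_cases hj : j = i
      · rw [hj, Function.update_self, hai]
        push_cast
        constructor <;> linarith
      · rw [Function.update_of_ne hj, ← haj j hj]
        exact hp' j
    · rw [dist_pi_le_iff zero_le_one]
      intro j
      by_cases hj : j = i
      · rw [hj, Function.update_self, Real.dist_eq]
        obtain ⟨h1, h2⟩ := hp' i
        exact abs_sub_le_iff.2 ⟨by linarith, by linarith⟩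
      · rw [Function.update_of_ne hj, dist_self]
        exact zero_le_one

/-- ADJOIN STEP ([Dimock2013] Lemma 20, proof, one cube): an admissible graph for A extends to one for A ∪ {c}, c a
cube having a common wall with a cube of A, at cost ≤ 1 (one segment inside the cube of A, ending on the common
wall). [cite: Dimock2013, §4 Lemma 20 (proof)] -/
theorem adjoin_step {A : Finset (Pt d)} {T : List (Seg d)} (hT : Admissible A T) {a c : Pt d} (ha : a ∈ A)
    (hac : Adj a c) : ∃ T', Admissible (insert c A) T' ∧ len T' ≤ len T + 1 := by
  obtain ⟨p, hpT, hpa⟩ := hT.meets a ha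
  obtain ⟨q, hqa, hqc, hpq⟩ := exists_wall_point hac hpa
  refine ⟨(p, q) :: T, ⟨?_, ?_, ?_⟩, ?_⟩
  · rw [carrier_cons]
    exact IsConnected.union ⟨p, left_mem_segment ℝ p q, hpT⟩
      ((convex_segment p q).isConnected ⟨p, left_mem_segment ℝ p q⟩) hT.connected
  · rw [carrier_cons, Set.union_subset_iff]
    exact ⟨((convex_cube a).segment_subset hpa hqa).trans (cube_subset_cubes (Finset.mem_insert_of_mem ha)),
      hT.subset.trans (cubes_mono (Finset.subset_insert c A))⟩
  · intro x hx
    rcases Finset.mem_insert.1 hx with rfl | hx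
    · exact ⟨q, Set.mem_union_left _ (right_mem_segment ℝ p q), hqc⟩
    · obtain ⟨r, hr, hrx⟩ := hT.meets x hx
      exact ⟨r, Set.mem_union_right _ hr, hrx⟩
  · rw [len_cons]
    change dist p q + len T ≤ len T + 1
    linarith

/-- FRONTIER CUBE: if X ⊆ Y, X is non-empty, Y is a localization domain and Y ⊄ X, then some cube of Y ∖ X has a
common wall with a cube of X (walk a chain of cubes of Y from a cube of X to a cube outside X). [folklore] -/
theorem exists_frontier {X Y : Finset (Pt d)} (hXY : X ⊆ Y) (hY : FaceConnected Y) {x₀ y : Pt d} (hx₀ : x₀ ∈ X)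
    (hy : y ∈ Y) (hyX : y ∉ X) : ∃ a ∈ X, ∃ c ∈ Y, c ∉ X ∧ Adj a c := by
  have key : ∀ z, Linked Y x₀ z → z ∈ X ∨ ∃ a ∈ X, ∃ c ∈ Y, c ∉ X ∧ Adj a c := by
    intro z hz
    unfold Linked at hz
    induction hz with
    | refl => exact Or.inl hx₀
    | @tail b c _ hbc ih =>
      rcases ih with hb | hfr
      · obtain ⟨-, hcY, hadj⟩ := hbc
        by_cases hc : c ∈ X
        · exact Or.inl hc
        · exact Or.inr ⟨b, hb, c, hcY, hc, hadj⟩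
      · exact Or.inr hfr
  rcases key y (hY x₀ (hXY hx₀) y hy) with h | h
  · exact absurd h hyX
  · exact h

/-- ADJOINING, iterated ([Dimock2013] Lemma 20, proof): an admissible graph for A ⊆ Y, Y a localization domain,
extends to an admissible graph for Y at total cost ≤ |Y ∖ A| (induction on |Y ∖ A| along frontier cubes). [cite: Dimock2013, §4 Lemma 20] -/
theorem exists_admissible_extend {Y : Finset (Pt d)} (hY : FaceConnected Y) :
    ∀ n : ℕ, ∀ (A : Finset (Pt d)) (T : List (Seg d)), A ⊆ Y → (Y \ A).card = n → Admissible A T →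
      ∃ T', Admissible Y T' ∧ len T' ≤ len T + n := by
  intro n
  induction n with
  | zero =>
    intro A T hAY hcard hT
    have hAeq : A = Y :=
      Finset.Subset.antisymm hAY (Finset.sdiff_eq_empty_iff_subset.1 (Finset.card_eq_zero.1 hcard))
    subst hAeq
    exact ⟨T, hT, by simp⟩
  | succ n ih =>
    intro A T hAY hcard hT
    obtain ⟨x₀, hx₀⟩ := hT.finset_nonempty
    have hne : (Y \ A).Nonempty := by
      rw [← Finset.card_pos, hcard]
      exact Nat.succ_pos n
    obtain ⟨y, hy⟩ := hne
    rw [Finset.mem_sdiff] at hy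
    obtain ⟨a, ha, c, hc, hcA, hac⟩ := exists_frontier hAY hY hx₀ hy.1 hy.2
    obtain ⟨T₁, hT₁, hlen₁⟩ := adjoin_step hT ha hac
    have hsub : insert c A ⊆ Y := Finset.insert_subset hc hAY
    have hcard' : (Y \ insert c A).card = n := by
      rw [Finset.sdiff_insert, Finset.card_erase_of_mem (Finset.mem_sdiff.2 ⟨hc, hcA⟩), hcard]
      simp
    obtain ⟨T', hT', hlen'⟩ := ih (insert c A) T₁ hsub hcard' hT₁
    refine ⟨T', hT', ?_⟩
    push_cast
    linarith

/-- An admissible graph for X ⊆ Y (Y a localization domain) extends to one for Y at cost ≤ |Y ∖ X|. [cite: Dimock2013, §4 Lemma 20] -/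
theorem exists_admissible_of_subset {X Y : Finset (Pt d)} (hXY : X ⊆ Y) (hY : FaceConnected Y) {T : List (Seg d)}
    (hT : Admissible X T) : ∃ T', Admissible Y T' ∧ len T' ≤ len T + ((Y \ X).card : ℝ) :=
  exists_admissible_extend hY _ X T hXY rfl hT

/-- Every localization domain Y (non-empty, face-connected) has an admissible graph, of length ≤ |Y|_cubes − 1 (grow
it from one corner point, one segment of length ≤ 1 per further cube). [cite: Balaban1988RG2Cluster, (2.30) p.18 (upper half)] -/
theorem exists_admissible {Y : Finset (Pt d)} (hY : Y.Nonempty) (hc : FaceConnected Y) :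
    ∃ T, Admissible Y T ∧ len T ≤ (Y.card : ℝ) - 1 := by
  obtain ⟨x, hx⟩ := hY
  have hxY : ({x} : Finset (Pt d)) ⊆ Y := Finset.singleton_subset_iff.2 hx
  obtain ⟨T', hT', hlen⟩ := exists_admissible_of_subset hxY hc (admissible_singleton x)
  refine ⟨T', hT', ?_⟩
  have h1 : (Y \ {x}).card + 1 = Y.card := by
    have := Finset.card_sdiff_add_card_eq_card hxY
    simpa using this
  have h2 : ((Y \ {x}).card : ℝ) = Y.card - 1 := by
    have h1' : (((Y \ {x}).card : ℕ) : ℝ) + 1 = (Y.card : ℝ) := by exact_mod_cast h1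
    linarith
  have h3 : len [(corner x, corner x)] = 0 := by simp
  linarith

/-- (2.30) p. 18, UPPER HALF, verbatim: *"d_k(Y) ≦ M⁻⁴|Y| − 1 (2.30) holding for localization domains Y ∈ 𝐃_k"* —
PROVED for `treeLen` (M⁻⁴|Y| = the number of cubes of Y = `Y.card`). [cite: Balaban1988RG2Cluster, (2.30) p.18 (upper half)] -/
theorem treeLen_le_card_sub_one {Y : Finset (Pt d)} (hY : Y.Nonempty) (hc : FaceConnected Y) :
    treeLen Y ≤ (Y.card : ℝ) - 1 := by
  obtain ⟨T, hT, hlen⟩ := exists_admissible hY hc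
  exact (treeLen_le_len hT).trans hlen

/-- A single cube has linear size 0. [cite: Balaban1987RG1, p.257 (linear size d_j)] -/
theorem treeLen_singleton (x : Pt d) : treeLen ({x} : Finset (Pt d)) = 0 :=
  le_antisymm (by simpa using treeLen_le_len (admissible_singleton x)) (treeLen_nonneg _)

/-- ADJOINING INEQUALITY — the statement of [Dimock2013] §4 Lemma 20, verbatim: *"For X, Y ∈ 𝒟_k and X ⊂ Y:
M d_M(Y) ≤ M|Y − X|_M + M d_M(X)"* — PROVED for `treeLen`: d(Y) ≤ |Y ∖ X| + d(X) for localization domains X ⊆ Y. [cite: Dimock2013, §4 Lemma 20] -/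
theorem treeLen_le_card_sdiff_add {X Y : Finset (Pt d)} (hX : X.Nonempty) (hXY : X ⊆ Y) (hXc : FaceConnected X)
    (hYc : FaceConnected Y) : treeLen Y ≤ ((Y \ X).card : ℝ) + treeLen X := by
  refine le_of_forall_pos_le_add fun ε hε => ?_
  have hne : ∃ T, Admissible X T := by
    obtain ⟨T, hT, -⟩ := exists_admissible hX hXc
    exact ⟨T, hT⟩
  obtain ⟨T, hT, hlt⟩ := exists_admissible_len_lt hne hε
  obtain ⟨T', hT', hlen'⟩ := exists_admissible_of_subset hXY hYc hT
  linarith [treeLen_le_len hT']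

/-- LEAF 2 of `…B13ScaleTransfer` DISCHARGED: `AdjoinLeaf d treeLen` holds as a theorem. [cite: Dimock2013, §4 Lemma 20] -/
theorem adjoinLeaf_treeLen : AdjoinLeaf d (treeLen (d := d)) :=
  fun _ _ hX hXY hXc hYc => treeLen_le_card_sdiff_add hX hXY hXc hYc

/-! ## Part 3. Exact coarsening under the homothety p ↦ p/L ([Dimock2013] proof of Lemma 10, first sentence) -/

/-- Scaling of a segment by the factor c. [folklore] -/
def scaleSeg (c : ℝ) (s : Seg d) : Seg d := (c • s.1, c • s.2)

/-- A homothety maps segments onto segments. [folklore] -/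
theorem image_smul_segment (c : ℝ) (p q : RPt d) :
    (fun z : RPt d => c • z) '' segment ℝ p q = segment ℝ (c • p) (c • q) := by
  have h := image_segment ℝ ((c • LinearMap.id : RPt d →ₗ[ℝ] RPt d).toAffineMap) p q
  have hf : ⇑((c • LinearMap.id : RPt d →ₗ[ℝ] RPt d).toAffineMap) = fun z : RPt d => c • z := by
    funext z
    simp
  rw [hf] at h
  simpa using h

/-- Carrier of a scaled graph = scaled carrier. [folklore] -/
theorem carrier_map_scaleSeg (c : ℝ) (T : List (Seg d)) :
    carrier (T.map (scaleSeg c)) = (fun z : RPt d => c • z) '' carrier T := by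
  induction T with
  | nil => simp
  | cons s T ih =>
    rw [List.map_cons, carrier_cons, carrier_cons, Set.image_union, image_smul_segment, ih]
    rfl

/-- Length of a scaled graph = |c| · length (here c ≥ 0). [folklore] -/
theorem len_map_scaleSeg {c : ℝ} (hc : 0 ≤ c) (T : List (Seg d)) : len (T.map (scaleSeg c)) = c * len T := by
  induction T with
  | nil => simp
  | cons s T ih =>
    rw [List.map_cons, len_cons, len_cons, ih]
    change dist (c • s.1) (c • s.2) + c * len T = c * (dist s.1 s.2 + len T)
    rw [dist_smul₀, Real.norm_of_nonneg hc]
    ring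

/-- The homothety p ↦ p/L maps the cube of index x into the π_{k+1}-cube (block of side L, rescaled to a unit cube)
of index `coarse L x` (⌊x_μ/L⌋)_μ. [cite: Balaban1988RG2Cluster, p.13 (cubes of the size LM)] -/
theorem smul_mem_cube_coarse {L : ℕ} (hL : 0 < L) {x : Pt d} {p : RPt d} (hp : p ∈ cube x) :
    (L : ℝ)⁻¹ • p ∈ cube (coarse L x) := by
  have hb := (coarse_eq_iff hL x (coarse L x)).1 rfl
  have hLr : (0 : ℝ) < L := by exact_mod_cast hL
  rw [mem_cube] at hp ⊢
  intro i
  obtain ⟨h1, h2⟩ := hb i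
  obtain ⟨h3, h4⟩ := hp i
  have h1' : (L : ℝ) * (coarse L x i : ℝ) ≤ (x i : ℝ) := by exact_mod_cast h1
  have h2i : x i + 1 ≤ (L : ℤ) * (coarse L x i + 1) := Int.lt_iff_add_one_le.1 h2
  have h2' : (x i : ℝ) + 1 ≤ (L : ℝ) * ((coarse L x i : ℝ) + 1) := by exact_mod_cast h2i
  simp only [Pi.smul_apply, smul_eq_mul]
  rw [inv_mul_eq_div]
  constructor
  · rw [le_div_iff₀ hLr]
    linarith
  · rw [div_le_iff₀ hLr]
    linarith

/-- The image under p ↦ p/L of an admissible graph for X is admissible for X̄ = `closureIdx L X` (the family of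
π_{k+1}-cubes met by X): [Dimock2013] §3, proof of Lemma 10, verbatim: *"If X̄ = Y then a minimal tree on the M blocks
in X is also a tree on the LM blocks in Y"* (here for every admissible graph, and with the rescaling to unit cubes
made explicit). [cite: Dimock2013, §3 Lemma 10 (reblocking), proof l.1] -/
theorem admissible_scale {L : ℕ} (hL : 0 < L) {X : Finset (Pt d)} {T : List (Seg d)} (hT : Admissible X T) :
    Admissible (closureIdx L X) (T.map (scaleSeg (L : ℝ)⁻¹)) := by
  have hcont : Continuous fun z : RPt d => (L : ℝ)⁻¹ • z := continuous_const_smul _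
  refine ⟨?_, ?_, ?_⟩
  · rw [carrier_map_scaleSeg]
    exact hT.connected.image _ hcont.continuousOn
  · rw [carrier_map_scaleSeg]
    rintro _ ⟨p, hp, rfl⟩
    obtain ⟨x, hx, hpx⟩ := mem_cubes.1 (hT.subset hp)
    refine mem_cubes.2 ⟨coarse L x, ?_, smul_mem_cube_coarse hL hpx⟩
    unfold closureIdx
    exact Finset.mem_image_of_mem _ hx
  · intro b hb
    unfold closureIdx at hb
    rw [Finset.mem_image] at hb
    obtain ⟨x, hx, rfl⟩ := hb
    obtain ⟨p, hp, hpx⟩ := hT.meets x hx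
    refine ⟨(L : ℝ)⁻¹ • p, ?_, smul_mem_cube_coarse hL hpx⟩
    rw [carrier_map_scaleSeg]
    exact Set.mem_image_of_mem _ hp

/-- EXACT COARSENING — [Dimock2013] §3, proof of Lemma 10, verbatim: *"… and so M d_M(X) ≥ LM d_{LM}(Y)"* — PROVED for
`treeLen`: L · d_{k+1}(X̄) ≤ d_k(X) for every localization domain X, X̄ = `closureIdx L X` (for L = 0 the left side
is 0). [cite: Dimock2013, §3 Lemma 10 (reblocking), proof l.1] -/
theorem mul_treeLen_closureIdx_le (L : ℕ) {X : Finset (Pt d)} (hX : X.Nonempty) (hc : FaceConnected X) :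
    (L : ℝ) * treeLen (closureIdx L X) ≤ treeLen X := by
  rcases Nat.eq_zero_or_pos L with rfl | hL
  · simpa using treeLen_nonneg X
  have hLr : (0 : ℝ) < L := by exact_mod_cast hL
  have hne : ∃ T, Admissible X T := by
    obtain ⟨T, hT, -⟩ := exists_admissible hX hc
    exact ⟨T, hT⟩
  refine le_treeLen hne fun T hT => ?_
  have h1 := treeLen_le_len (admissible_scale hL hT)
  rw [len_map_scaleSeg (inv_nonneg.2 hLr.le)] at h1
  calc (L : ℝ) * treeLen (closureIdx L X) ≤ (L : ℝ) * ((L : ℝ)⁻¹ * len T) :=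
        mul_le_mul_of_nonneg_left h1 hLr.le
    _ = len T := by field_simp

/-- LEAF 1 of `…B13ScaleTransfer` DISCHARGED: `CoarseningLeaf d L treeLen` holds as a theorem, for every L. [cite: Dimock2013, §3 Lemma 10 (reblocking), proof l.1] -/
theorem coarseningLeaf_treeLen (L : ℕ) : CoarseningLeaf d L (treeLen (d := d)) :=
  fun _ hX hc => mul_treeLen_closureIdx_le L hX hc

/-! ## Part 4. [Balaban1988RG2Cluster] (2.27): gluing the graphs of a family with connected union -/

/-- JOIN THROUGH A COMMON CUBE: admissible graphs for A and for B with a common cube c glue to an admissible graph for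
B ∪ A at cost ≤ 1 (a segment inside the cube c). [cite: Balaban1988RG2Cluster, (2.27) p.18] -/
theorem admissible_join_common {A B : Finset (Pt d)} {TA TB : List (Seg d)} (hA : Admissible A TA)
    (hB : Admissible B TB) {c : Pt d} (hcA : c ∈ A) (hcB : c ∈ B) :
    ∃ T, Admissible (B ∪ A) T ∧ len T ≤ len TB + len TA + 1 := by
  obtain ⟨p, hpT, hpc⟩ := hA.meets c hcA
  obtain ⟨q, hqT, hqc⟩ := hB.meets c hcB
  refine ⟨TB ++ ((q, p) :: TA), ⟨?_, ?_, ?_⟩, ?_⟩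
  · rw [carrier_append, carrier_cons]
    refine IsConnected.union ⟨q, hqT, Set.mem_union_left _ (left_mem_segment ℝ q p)⟩ hB.connected ?_
    exact IsConnected.union ⟨p, right_mem_segment ℝ q p, hpT⟩
      ((convex_segment q p).isConnected ⟨q, left_mem_segment ℝ q p⟩) hA.connected
  · rw [carrier_append, carrier_cons]
    refine Set.union_subset (hB.subset.trans (cubes_mono Finset.subset_union_left)) (Set.union_subset ?_
      (hA.subset.trans (cubes_mono Finset.subset_union_right)))
    exact ((convex_cube c).segment_subset hqc hpc).trans (cube_subset_cubes (Finset.mem_union_right _ hcA))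
  · intro x hx
    rw [carrier_append, carrier_cons]
    rcases Finset.mem_union.1 hx with hx | hx
    · obtain ⟨r, hr, hrx⟩ := hB.meets x hx
      exact ⟨r, Set.mem_union_left _ hr, hrx⟩
    · obtain ⟨r, hr, hrx⟩ := hA.meets x hx
      exact ⟨r, Set.mem_union_right _ (Set.mem_union_right _ hr), hrx⟩
  · rw [len_append, len_cons]
    change len TB + (dist q p + len TA) ≤ len TB + len TA + 1
    linarith [dist_le_one_of_mem_cube hqc hpc]

/-- JOIN THROUGH ADJACENT CUBES: admissible graphs for A and for B, with a cube a of A having a common wall with a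
cube c of B, glue to an admissible graph for B ∪ A at cost ≤ 2 (a segment inside cube a to the common wall, then a
segment inside cube c). [cite: Balaban1988RG2Cluster, (2.27) p.18] -/
theorem admissible_join_adj {A B : Finset (Pt d)} {TA TB : List (Seg d)} (hA : Admissible A TA)
    (hB : Admissible B TB) {a c : Pt d} (haA : a ∈ A) (hcB : c ∈ B) (hac : Adj a c) :
    ∃ T, Admissible (B ∪ A) T ∧ len T ≤ len TB + len TA + 2 := by
  obtain ⟨p, hpT, hpa⟩ := hA.meets a haA
  obtain ⟨q, hqT, hqc⟩ := hB.meets c hcB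
  obtain ⟨w, hwa, hwc, hpw⟩ := exists_wall_point hac hpa
  refine ⟨TB ++ ((q, w) :: (w, p) :: TA), ⟨?_, ?_, ?_⟩, ?_⟩
  · rw [carrier_append, carrier_cons, carrier_cons]
    have h3 : IsConnected (segment ℝ w p ∪ carrier TA) :=
      IsConnected.union ⟨p, right_mem_segment ℝ w p, hpT⟩
        ((convex_segment w p).isConnected ⟨w, left_mem_segment ℝ w p⟩) hA.connected
    have h2 : IsConnected (segment ℝ q w ∪ (segment ℝ w p ∪ carrier TA)) :=
      IsConnected.union ⟨w, right_mem_segment ℝ q w, Set.mem_union_left _ (left_mem_segment ℝ w p)⟩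
        ((convex_segment q w).isConnected ⟨q, left_mem_segment ℝ q w⟩) h3
    exact IsConnected.union ⟨q, hqT, Set.mem_union_left _ (left_mem_segment ℝ q w)⟩ hB.connected h2
  · rw [carrier_append, carrier_cons, carrier_cons]
    refine Set.union_subset (hB.subset.trans (cubes_mono Finset.subset_union_left))
      (Set.union_subset ?_ (Set.union_subset ?_ (hA.subset.trans (cubes_mono Finset.subset_union_right))))
    · exact ((convex_cube c).segment_subset hqc hwc).trans (cube_subset_cubes (Finset.mem_union_left _ hcB))
    · exact ((convex_cube a).segment_subset hwa hpa).trans (cube_subset_cubes (Finset.mem_union_right _ haA))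
  · intro x hx
    rw [carrier_append, carrier_cons, carrier_cons]
    rcases Finset.mem_union.1 hx with hx | hx
    · obtain ⟨r, hr, hrx⟩ := hB.meets x hx
      exact ⟨r, Set.mem_union_left _ hr, hrx⟩
    · obtain ⟨r, hr, hrx⟩ := hA.meets x hx
      exact ⟨r, Set.mem_union_right _ (Set.mem_union_right _ (Set.mem_union_right _ hr)), hrx⟩
  · rw [len_append, len_cons, len_cons]
    change len TB + (dist q w + (dist w p + len TA)) ≤ len TB + len TA + 2
    linarith [dist_le_one_of_mem_cube hqc hwc, dist_le_one_of_mem_cube hwa hpa]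

/-- GLUING INDUCTION for (2.27): given admissible graphs `f Y` for the members of a finite family 𝐃 with
face-connected union, and a glued admissible graph for the union of a subfamily G at cost Σ_{Y∈G} len(f Y) + 2(|G| −
1), the whole family glues at cost Σ_{Y∈𝐃} len(f Y) + 2(|𝐃| − 1): a member outside G either shares a cube with the
union of G (`admissible_join_common`) or, all outside members being disjoint from it, a frontier cube of the union
of 𝐃 supplies an adjacent pair (`admissible_join_adj`). [cite: Balaban1988RG2Cluster, (2.27) p.18] -/
theorem exists_admissible_glue {D : Finset (Finset (Pt d))} (hU : FaceConnected (D.biUnion id))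
    {f : Finset (Pt d) → List (Seg d)} (hf : ∀ Y ∈ D, Admissible Y (f Y)) :
    ∀ n : ℕ, ∀ G : Finset (Finset (Pt d)), G ⊆ D → G.Nonempty → (D \ G).card = n →
      (∃ T, Admissible (G.biUnion id) T ∧ len T ≤ ∑ Y ∈ G, len (f Y) + 2 * ((G.card : ℝ) - 1)) →
      ∃ T, Admissible (D.biUnion id) T ∧ len T ≤ ∑ Y ∈ D, len (f Y) + 2 * ((D.card : ℝ) - 1) := by
  intro n
  induction n with
  | zero =>
    intro G hGD _ hcard hT
    have hGeq : G = D :=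
      Finset.Subset.antisymm hGD (Finset.sdiff_eq_empty_iff_subset.1 (Finset.card_eq_zero.1 hcard))
    subst hGeq
    exact hT
  | succ n ih =>
    intro G hGD hGne hcard hT
    obtain ⟨T, hT, hlen⟩ := hT
    obtain ⟨Y', hY'D, hY'G, T₁, hT₁, hlen₁⟩ : ∃ Y' ∈ D, Y' ∉ G ∧
        ∃ T₁, Admissible (Y' ∪ G.biUnion id) T₁ ∧ len T₁ ≤ len (f Y') + len T + 2 := by
      by_cases hmeet : ∃ Y' ∈ D, Y' ∉ G ∧ ∃ c ∈ Y', c ∈ G.biUnion id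
      · obtain ⟨Y', hY'D, hY'G, c, hcY', hcA⟩ := hmeet
        obtain ⟨T₁, hT₁, hlen₁⟩ := admissible_join_common hT (hf Y' hY'D) hcA hcY'
        exact ⟨Y', hY'D, hY'G, T₁, hT₁, by linarith⟩
      · push Not at hmeet
        have hne : (D \ G).Nonempty := by
          rw [← Finset.card_pos, hcard]
          exact Nat.succ_pos n
        obtain ⟨Y'', hY''⟩ := hne
        rw [Finset.mem_sdiff] at hY''
        obtain ⟨y, hy⟩ := (hf Y'' hY''.1).finset_nonempty
        have hyU : y ∈ D.biUnion id := Finset.mem_biUnion.2 ⟨Y'', hY''.1, hy⟩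
        have hyA : y ∉ G.biUnion id := hmeet Y'' hY''.1 hY''.2 y hy
        have hAU : G.biUnion id ⊆ D.biUnion id := Finset.biUnion_subset_biUnion_of_subset_left _ hGD
        obtain ⟨Y₁, hY₁⟩ := hGne
        obtain ⟨x₀, hx₀⟩ := (hf Y₁ (hGD hY₁)).finset_nonempty
        have hx₀A : x₀ ∈ G.biUnion id := Finset.mem_biUnion.2 ⟨Y₁, hY₁, hx₀⟩
        obtain ⟨a, haA, c, hcU, hcA, hac⟩ := exists_frontier hAU hU hx₀A hyU hyA
        obtain ⟨Y', hY'D, hcY'⟩ := Finset.mem_biUnion.1 hcU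
        have hY'G : Y' ∉ G := fun h => hcA (Finset.mem_biUnion.2 ⟨Y', h, hcY'⟩)
        obtain ⟨T₁, hT₁, hlen₁⟩ := admissible_join_adj hT (hf Y' hY'D) haA hcY' hac
        exact ⟨Y', hY'D, hY'G, T₁, hT₁, by linarith⟩
    have hsub : insert Y' G ⊆ D := Finset.insert_subset hY'D hGD
    have hcard' : (D \ insert Y' G).card = n := by
      rw [Finset.sdiff_insert, Finset.card_erase_of_mem (Finset.mem_sdiff.2 ⟨hY'D, hY'G⟩), hcard]
      simp
    refine ih (insert Y' G) hsub (Finset.insert_nonempty _ _) hcard' ⟨T₁, ?_, ?_⟩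
    · rw [Finset.biUnion_insert]
      exact hT₁
    · rw [Finset.sum_insert hY'G, Finset.card_insert_of_notMem hY'G]
      push_cast
      linarith

/-- (2.27), graph form: admissible graphs `f Y` of the members of a non-empty finite family 𝐃 of index sets with
face-connected union Y₀ glue to an admissible graph for Y₀ of length ≤ Σ_{Y∈𝐃} len(f Y) + 2(|𝐃| − 1). [cite: Balaban1988RG2Cluster, (2.27) p.18] -/
theorem exists_admissible_biUnion {D : Finset (Finset (Pt d))} (hD : D.Nonempty)
    (hU : FaceConnected (D.biUnion id)) {f : Finset (Pt d) → List (Seg d)} (hf : ∀ Y ∈ D, Admissible Y (f Y)) :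
    ∃ T, Admissible (D.biUnion id) T ∧ len T ≤ ∑ Y ∈ D, len (f Y) + 2 * ((D.card : ℝ) - 1) := by
  obtain ⟨Y₁, hY₁⟩ := hD
  refine exists_admissible_glue hU hf _ {Y₁} (Finset.singleton_subset_iff.2 hY₁) (Finset.singleton_nonempty _)
    rfl ⟨f Y₁, ?_, ?_⟩
  · rw [Finset.singleton_biUnion]
    exact hf Y₁ hY₁
  · simp

/-- (2.27) SHARPENED, PROVED for `treeLen`: for a non-empty finite family 𝐃 of localization domains whose union Y₀ is
a localization domain, d_k(Y₀) + 2 ≤ Σ_{Y∈𝐃} (d_k(Y) + 2) — [Balaban1988RG2Cluster] p. 18: *"Because ⋃_{Y∈𝐃} Y = Y₀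
and Y₀ is a connected domain, hence the definition of d_k(Y) implies the inequality"* (printed with the constant 5,
`ineq227_treeLen`). [cite: Balaban1988RG2Cluster, (2.27) p.18] -/
theorem treeLen_biUnion_add_two_le {D : Finset (Finset (Pt d))} (hD : D.Nonempty)
    (hmem : ∀ Y ∈ D, Y.Nonempty ∧ FaceConnected Y) (hU : FaceConnected (D.biUnion id)) :
    treeLen (D.biUnion id) + 2 ≤ ∑ Y ∈ D, (treeLen Y + 2) := by
  refine le_of_forall_pos_le_add fun ε hε => ?_
  have hDpos : (0 : ℝ) < D.card := by exact_mod_cast Finset.card_pos.2 hD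
  obtain ⟨δ, hδpos, hδ⟩ : ∃ δ : ℝ, 0 < δ ∧ (D.card : ℝ) * δ = ε :=
    ⟨ε / D.card, div_pos hε hDpos, by field_simp⟩
  have hch : ∀ Y ∈ D, ∃ T, Admissible Y T ∧ len T < treeLen Y + δ := by
    intro Y hY
    have hne : ∃ T, Admissible Y T := by
      obtain ⟨T, hT, -⟩ := exists_admissible (hmem Y hY).1 (hmem Y hY).2
      exact ⟨T, hT⟩
    exact exists_admissible_len_lt hne hδpos
  choose! f hf hflen using hch
  obtain ⟨T, hT, hlen⟩ := exists_admissible_biUnion hD hU hf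
  have h1 := treeLen_le_len hT
  have h2 : ∑ Y ∈ D, len (f Y) ≤ ∑ Y ∈ D, (treeLen Y + δ) :=
    Finset.sum_le_sum fun Y hY => (hflen Y hY).le
  rw [Finset.sum_add_distrib, Finset.sum_const, nsmul_eq_mul] at h2
  rw [Finset.sum_add_distrib, Finset.sum_const, nsmul_eq_mul]
  linarith

/-- (2.27) AS PRINTED, PROVED for `treeLen`, verbatim: *"Σ_{Y∈𝐃} (d_k(Y) + 5) ≧ d_k(Y₀) + 5. (2.27)"* — for a
non-empty finite family 𝐃 of localization domains with ⋃_{Y∈𝐃} Y = Y₀ a localization domain. [cite: Balaban1988RG2Cluster, (2.27) p.18] -/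
theorem ineq227_treeLen {D : Finset (Finset (Pt d))} (hD : D.Nonempty)
    (hmem : ∀ Y ∈ D, Y.Nonempty ∧ FaceConnected Y) (hU : FaceConnected (D.biUnion id)) :
    treeLen (D.biUnion id) + 5 ≤ ∑ Y ∈ D, (treeLen Y + 5) := by
  have h := treeLen_biUnion_add_two_le hD hmem hU
  have hD1 : (1 : ℝ) ≤ D.card := by
    have h0 : 1 ≤ D.card := Finset.card_pos.2 hD
    exact_mod_cast h0
  rw [Finset.sum_add_distrib, Finset.sum_const, nsmul_eq_mul] at h ⊢
  linarith

/-- (2.27) ⇒ (2.28) with the length instantiated: `B13.prod_bound_228` (unit b13: the product bound (2.28) p. 18 from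
an abstract (2.27)-type hypothesis `d₀ + 5 ≤ Σ (d i + 5)`) applied with d := `treeLen` on the members of 𝐃 and d₀ :=
`treeLen` of their union — the hypothesis is now the THEOREM `ineq227_treeLen`. [cite: Balaban1988RG2Cluster, (2.27)–(2.28) p.18] -/
theorem prod_bound_228_treeLen {D : Finset (Finset (Pt d))} (hD : D.Nonempty)
    (hmem : ∀ Y ∈ D, Y.Nonempty ∧ FaceConnected Y) (hU : FaceConnected (D.biUnion id)) (A r r' : ℝ)
    (hA : 0 ≤ A) (hr : 0 ≤ r) (hrr : r ≤ r') (hsmall : A * Real.exp (5 * r') ≤ 1) :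
    ∏ Y ∈ D, (A * Real.exp (-(r * treeLen Y))) ≤ A * Real.exp (-(r * treeLen (D.biUnion id))) :=
  B13.prod_bound_228 D hD treeLen A r r' (treeLen (D.biUnion id)) hA hr hrr hsmall (ineq227_treeLen hD hmem hU)


open MeasureTheory

/-! ## Part 5. Length of a graph inside a region (Lebesgue measure on the segment parameters) -/

/-- Membership in the carrier of a graph: in one of its segments. [folklore] -/
theorem mem_carrier {T : List (Seg d)} {z : RPt d} : z ∈ carrier T ↔ ∃ s ∈ T, z ∈ segment ℝ s.1 s.2 := by
  induction T with
  | nil => simp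
  | cons s T ih => simp [ih]

/-- Each segment of a graph lies in its carrier. [folklore] -/
theorem segment_subset_carrier {T : List (Seg d)} {s : Seg d} (hs : s ∈ T) :
    segment ℝ s.1 s.2 ⊆ carrier T :=
  fun _ hz => mem_carrier.2 ⟨s, hs, hz⟩

/-- The affine parametrisation t ↦ s₁ + t (s₂ − s₁) of a segment. [folklore] -/
def gam (s : Seg d) (t : ℝ) : RPt d := s.1 + t • (s.2 - s.1)

/-- The parametrisation is continuous. [folklore] -/
theorem continuous_gam (s : Seg d) : Continuous (gam s) := by
  unfold gam; fun_prop

/-- A segment is the image of [0, 1] under its parametrisation. [folklore] -/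
theorem segment_eq_image_gam (s : Seg d) : segment ℝ s.1 s.2 = gam s '' Set.Icc (0 : ℝ) 1 :=
  segment_eq_image' ℝ s.1 s.2

/-- Coordinates of the parametrisation: (γ_s t)_μ = (s₁)_μ + t ((s₂)_μ − (s₁)_μ). [folklore] -/
theorem gam_apply (s : Seg d) (t : ℝ) (μ : Fin d) : gam s t μ = s.1 μ + t * (s.2 μ - s.1 μ) := by
  simp [gam, smul_eq_mul]

/-- Segments are closed. [folklore] -/
theorem isClosed_segment' (s : Seg d) : IsClosed (segment ℝ s.1 s.2) := by
  rw [segment_eq_image_gam]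
  exact (isCompact_Icc.image (continuous_gam s)).isClosed

/-- The parameter set of the part of the segment s lying in the region B: {t ∈ [0,1] | γ_s(t) ∈ B}. [folklore] -/
def paramIn (B : Set (RPt d)) (s : Seg d) : Set ℝ := Set.Icc (0 : ℝ) 1 ∩ gam s ⁻¹' B

/-- The parameter set lies in [0, 1]. [folklore] -/
theorem paramIn_subset_Icc (B : Set (RPt d)) (s : Seg d) : paramIn B s ⊆ Set.Icc 0 1 :=
  Set.inter_subset_left

/-- For a closed region the parameter set is closed (hence measurable). [folklore] -/
theorem isClosed_paramIn {B : Set (RPt d)} (hB : IsClosed B) (s : Seg d) : IsClosed (paramIn B s) :=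
  isClosed_Icc.inter (hB.preimage (continuous_gam s))

/-- The parameter set has Lebesgue measure ≤ 1. [folklore] -/
theorem volume_paramIn_le_one (B : Set (RPt d)) (s : Seg d) : volume (paramIn B s) ≤ 1 := by
  calc volume (paramIn B s) ≤ volume (Set.Icc (0 : ℝ) 1) := measure_mono (paramIn_subset_Icc B s)
    _ = 1 := by simp [Real.volume_Icc]

/-- The parameter set has finite measure. [folklore] -/
theorem volume_paramIn_ne_top (B : Set (RPt d)) (s : Seg d) : volume (paramIn B s) ≠ ⊤ :=
  ne_top_of_le_ne_top ENNReal.one_ne_top (volume_paramIn_le_one B s)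

/-- THE LENGTH OF A GRAPH INSIDE A REGION B: Σ_s |s| · Leb{t ∈ [0,1] | γ_s(t) ∈ B} — the natural (Lebesgue) length
of T ∩ B, segment by segment. [folklore] -/
def lenIn (B : Set (RPt d)) : List (Seg d) → ℝ
  | [] => 0
  | s :: T => dist s.1 s.2 * (volume (paramIn B s)).toReal + lenIn B T

/-- The empty graph has no length inside B. [folklore] -/
@[simp] theorem lenIn_nil (B : Set (RPt d)) : lenIn B ([] : List (Seg d)) = 0 := rfl

/-- Length inside B of a graph with one more segment. [folklore] -/
@[simp] theorem lenIn_cons (B : Set (RPt d)) (s : Seg d) (T : List (Seg d)) :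
    lenIn B (s :: T) = dist s.1 s.2 * (volume (paramIn B s)).toReal + lenIn B T := rfl

/-- Length inside a region is non-negative. [folklore] -/
theorem lenIn_nonneg (B : Set (RPt d)) (T : List (Seg d)) : 0 ≤ lenIn B T := by
  induction T with
  | nil => simp
  | cons s T ih => rw [lenIn_cons]; positivity

/-- ADDITIVITY OVER DISJOINT REGIONS: for pairwise disjoint closed regions B_k, Σ_k (length of T inside B_k) ≤ |T|
(the parameter sets of one segment are pairwise disjoint measurable subsets of [0, 1]). [folklore] -/
theorem sum_lenIn_le_len {ι : Type*} (K : Finset ι) (B : ι → Set (RPt d)) (hB : ∀ k ∈ K, IsClosed (B k))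
    (hdis : (K : Set ι).PairwiseDisjoint B) (T : List (Seg d)) : ∑ k ∈ K, lenIn (B k) T ≤ len T := by
  induction T with
  | nil => simp
  | cons s T ih =>
    simp only [lenIn_cons, len_cons, Finset.sum_add_distrib]
    have h1 : ∑ k ∈ K, (volume (paramIn (B k) s)).toReal ≤ 1 := by
      rw [← ENNReal.toReal_sum (fun k _ => volume_paramIn_ne_top (B k) s)]
      have hd' : (K : Set ι).PairwiseDisjoint (fun k => paramIn (B k) s) := by
        intro i hi j hj hij
        have hij' : Disjoint (B i) (B j) := hdis hi hj hij
        exact (Disjoint.preimage (gam s) hij').mono Set.inter_subset_right Set.inter_subset_right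
      rw [← measure_biUnion_finset hd' (fun k hk => (isClosed_paramIn (hB k hk) s).measurableSet)]
      refine ENNReal.toReal_le_of_le_ofReal zero_le_one ?_
      rw [ENNReal.ofReal_one]
      calc volume (⋃ k ∈ K, paramIn (B k) s) ≤ volume (Set.Icc (0 : ℝ) 1) :=
            measure_mono (Set.iUnion₂_subset fun k _ => paramIn_subset_Icc (B k) s)
        _ = 1 := by simp [Real.volume_Icc]
    have hs : ∑ k ∈ K, dist s.1 s.2 * (volume (paramIn (B k) s)).toReal ≤ dist s.1 s.2 := by
      rw [← Finset.mul_sum]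
      calc dist s.1 s.2 * ∑ k ∈ K, (volume (paramIn (B k) s)).toReal ≤ dist s.1 s.2 * 1 :=
            mul_le_mul_of_nonneg_left h1 dist_nonneg
        _ = dist s.1 s.2 := mul_one _
    linarith

/-! ## Part 6. Capture: a connected graph through the centre of a ball that leaves the ball has length ≥ radius inside -/

/-- EXIT LEMMA. If the carrier of T is preconnected, contains p and a point at distance ≥ ρ from p, then the connected
component of p in (carrier T) ∩ B̄(p, ρ) contains a point at distance ≥ ρ from p (it reaches the boundary).  Proof:
otherwise every segment meeting the component lies in it (maximality of the component + connectedness of a segment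
missing the sphere), so the component and the union of the remaining segments split the carrier into two disjoint
closed pieces. [folklore] -/
theorem exists_far_mem_component {T : List (Seg d)} (hT : IsPreconnected (carrier T)) {p q₀ : RPt d}
    (hp : p ∈ carrier T) (hq₀ : q₀ ∈ carrier T) {ρ : ℝ} (hρ : 0 ≤ ρ) (hρq : ρ ≤ dist p q₀) :
    ∃ q ∈ connectedComponentIn (carrier T ∩ Metric.closedBall p ρ) p, ρ ≤ dist p q := by
  set F := carrier T ∩ Metric.closedBall p ρ with hF
  set K := connectedComponentIn F p with hK
  have hpF : p ∈ F := ⟨hp, Metric.mem_closedBall_self hρ⟩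
  have hpK : p ∈ K := mem_connectedComponentIn hpF
  have hKF : K ⊆ F := connectedComponentIn_subset F p
  by_contra h
  push Not at h
  have claim1 : ∀ s ∈ T, (segment ℝ s.1 s.2 ∩ K).Nonempty → segment ℝ s.1 s.2 ⊆ K := by
    intro s hs hne
    obtain ⟨z, hzs, hzK⟩ := hne
    have hsub : segment ℝ s.1 s.2 ∩ Metric.closedBall p ρ ⊆ K := by
      have hpre : IsPreconnected (K ∪ segment ℝ s.1 s.2 ∩ Metric.closedBall p ρ) :=
        IsPreconnected.union' ⟨z, hzK, hzs, (hKF hzK).2⟩ isPreconnected_connectedComponentIn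
          ((convex_segment s.1 s.2).inter (convex_closedBall p ρ)).isPreconnected
      have hKK := hpre.subset_connectedComponentIn (Set.mem_union_left _ hpK)
        (Set.union_subset hKF (fun w hw => ⟨segment_subset_carrier hs hw.1, hw.2⟩))
      exact fun w hw => hKK (Set.mem_union_right _ hw)
    have hball : segment ℝ s.1 s.2 ⊆ Metric.ball p ρ := by
      refine IsPreconnected.subset_left_of_subset_union (v := (Metric.closedBall p ρ)ᶜ) Metric.isOpen_ball
        Metric.isClosed_closedBall.isOpen_compl ?_ ?_ ?_ (convex_segment s.1 s.2).isPreconnected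
      · exact Set.disjoint_compl_right_iff_subset.mpr Metric.ball_subset_closedBall
      · intro w hw
        by_cases hwB : w ∈ Metric.closedBall p ρ
        · left
          rw [Metric.mem_ball, dist_comm]
          exact h w (hsub ⟨hw, hwB⟩)
        · right
          exact hwB
      · refine ⟨z, hzs, ?_⟩
        rw [Metric.mem_ball, dist_comm]
        exact h z hzK
    intro w hw
    exact hsub ⟨hw, Metric.ball_subset_closedBall (hball hw)⟩
  set I : Set (Seg d) := {s | s ∈ T ∧ (segment ℝ s.1 s.2 ∩ K).Nonempty} with hI
  set J : Set (Seg d) := {s | s ∈ T ∧ ¬ (segment ℝ s.1 s.2 ∩ K).Nonempty} with hJ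
  have hfin : {s : Seg d | s ∈ T}.Finite := T.finite_toSet
  have huc : IsClosed (⋃ s ∈ I, segment ℝ s.1 s.2) :=
    (hfin.subset (fun s hs => hs.1)).isClosed_biUnion fun s _ => isClosed_segment' s
  have hvc : IsClosed (⋃ s ∈ J, segment ℝ s.1 s.2) :=
    (hfin.subset (fun s hs => hs.1)).isClosed_biUnion fun s _ => isClosed_segment' s
  have huK : (⋃ s ∈ I, segment ℝ s.1 s.2) ⊆ K := Set.iUnion₂_subset fun s hs => claim1 s hs.1 hs.2
  have hcov : carrier T ⊆ (⋃ s ∈ I, segment ℝ s.1 s.2) ∪ (⋃ s ∈ J, segment ℝ s.1 s.2) := by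
    intro z hz
    obtain ⟨s, hs, hzs⟩ := mem_carrier.1 hz
    by_cases hc : (segment ℝ s.1 s.2 ∩ K).Nonempty
    · exact Or.inl (Set.mem_biUnion (show s ∈ I from ⟨hs, hc⟩) hzs)
    · exact Or.inr (Set.mem_biUnion (show s ∈ J from ⟨hs, hc⟩) hzs)
  have hdisj : carrier T ∩ ((⋃ s ∈ I, segment ℝ s.1 s.2) ∩ (⋃ s ∈ J, segment ℝ s.1 s.2)) = ∅ := by
    ext z
    simp only [Set.mem_inter_iff, Set.mem_empty_iff_false, iff_false, not_and]
    intro _ hzu hzv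
    obtain ⟨s, hs, hzs⟩ := Set.mem_iUnion₂.1 hzv
    exact hs.2 ⟨z, hzs, huK hzu⟩
  rcases (isPreconnected_iff_subset_of_disjoint_closed.1 hT) _ _ huc hvc hcov hdisj with hTu | hTv
  · exact absurd (h q₀ (huK (hTu hq₀))) (not_lt.2 hρq)
  · obtain ⟨s, hs, hps⟩ := Set.mem_iUnion₂.1 (hTv hp)
    exact hs.2 ⟨p, hps, hpK⟩

/-- Lebesgue measure of the image of a set A ⊆ ℝ under an affine map t ↦ a + t b is |b| · Leb(A) (≤; = for b ≠ 0). [folklore] -/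
theorem volume_image_affine_le (a b : ℝ) (A : Set ℝ) :
    volume ((fun t => a + t * b) '' A) ≤ ENNReal.ofReal |b| * volume A := by
  rcases eq_or_ne b 0 with rfl | hb
  · have hsub : (fun t : ℝ => a + t * 0) '' A ⊆ {a} := by
      rintro _ ⟨t, -, rfl⟩
      simp
    calc volume ((fun t : ℝ => a + t * 0) '' A) ≤ volume ({a} : Set ℝ) := measure_mono hsub
      _ = 0 := Real.volume_singleton
      _ ≤ _ := bot_le
  · have hset : (fun t => a + t * b) '' A = (fun y => y + -a) ⁻¹' ((fun z => b⁻¹ * z) ⁻¹' A) := by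
      ext y
      simp only [Set.mem_image, Set.mem_preimage]
      constructor
      · rintro ⟨t, ht, rfl⟩
        have : b⁻¹ * (a + t * b + -a) = t := by field_simp; ring
        rwa [this]
      · intro hy
        exact ⟨b⁻¹ * (y + -a), hy, by field_simp; ring⟩
    rw [hset, measure_preimage_add_right, Real.volume_preimage_mul_left (inv_ne_zero hb), inv_inv]

/-- The union over the segments s of T of the μ-th coordinate projections of γ_s(paramIn B s), i.e. of the
projections of the parts s ∩ B (as a list-indexed union). [folklore] -/
def projU (μ : Fin d) (B : Set (RPt d)) : List (Seg d) → Set ℝ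
  | [] => ∅
  | s :: T => (fun t => s.1 μ + t * (s.2 μ - s.1 μ)) '' paramIn B s ∪ projU μ B T

/-- Membership in `projU`. [folklore] -/
theorem mem_projU {μ : Fin d} {B : Set (RPt d)} {T : List (Seg d)} {y : ℝ} :
    y ∈ projU μ B T ↔ ∃ s ∈ T, y ∈ (fun t => s.1 μ + t * (s.2 μ - s.1 μ)) '' paramIn B s := by
  induction T with
  | nil => simp [projU]
  | cons s T ih =>
    simp only [projU, Set.mem_union, ih, List.mem_cons, exists_eq_or_imp]

/-- The projected parts have total Lebesgue measure at most the length of T inside B. [folklore] -/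
theorem volume_projU_le (μ : Fin d) (B : Set (RPt d)) (T : List (Seg d)) :
    volume (projU μ B T) ≤ ENNReal.ofReal (lenIn B T) := by
  induction T with
  | nil => simp [projU]
  | cons s T ih =>
    rw [projU, lenIn_cons, ENNReal.ofReal_add (by positivity) (lenIn_nonneg B T)]
    refine (measure_union_le _ _).trans (add_le_add ?_ ih)
    calc volume ((fun t => s.1 μ + t * (s.2 μ - s.1 μ)) '' paramIn B s)
        ≤ ENNReal.ofReal |s.2 μ - s.1 μ| * volume (paramIn B s) := volume_image_affine_le _ _ _
      _ ≤ ENNReal.ofReal (dist s.1 s.2) * volume (paramIn B s) := by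
          gcongr
          calc |s.2 μ - s.1 μ| = dist (s.1 μ) (s.2 μ) := by rw [Real.dist_eq, abs_sub_comm]
            _ ≤ dist s.1 s.2 := dist_le_pi_dist s.1 s.2 μ
      _ = ENNReal.ofReal (dist s.1 s.2 * (volume (paramIn B s)).toReal) := by
          rw [ENNReal.ofReal_mul dist_nonneg, ENNReal.ofReal_toReal (volume_paramIn_ne_top B s)]

/-- CAPTURE LEMMA. If the carrier of T is preconnected and contains p and a point at distance ≥ ρ > 0 from p, then
the length of T inside the closed ball B̄(p, ρ) is at least ρ.  Proof: the component of p in T ∩ B̄ reaches the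
boundary (exit lemma) at a point q; for a coordinate μ with |p_μ − q_μ| ≥ ρ the μ-projection of the component is an
interval of length ≥ ρ covered by the projections of the parts s ∩ B̄, whose Lebesgue measures add up to at most the
length inside. [folklore] -/
theorem le_lenIn_closedBall {T : List (Seg d)} (hT : IsPreconnected (carrier T)) {p q₀ : RPt d}
    (hp : p ∈ carrier T) (hq₀ : q₀ ∈ carrier T) {ρ : ℝ} (hρ : 0 < ρ) (hρq : ρ ≤ dist p q₀) :
    ρ ≤ lenIn (Metric.closedBall p ρ) T := by
  obtain ⟨q, hqK, hq⟩ := exists_far_mem_component hT hp hq₀ hρ.le hρq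
  set B := Metric.closedBall p ρ with hB
  have hKpre : IsPreconnected (connectedComponentIn (carrier T ∩ B) p) := isPreconnected_connectedComponentIn
  have hKF : connectedComponentIn (carrier T ∩ B) p ⊆ carrier T ∩ B := connectedComponentIn_subset _ _
  have hpK : p ∈ connectedComponentIn (carrier T ∩ B) p :=
    mem_connectedComponentIn ⟨hp, Metric.mem_closedBall_self hρ.le⟩
  obtain ⟨μ, hμ⟩ : ∃ μ, ρ ≤ dist (p μ) (q μ) := by
    by_contra hcon
    push Not at hcon
    exact absurd hq (not_le.2 ((dist_pi_lt_iff hρ).2 hcon))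
  have hproj : Set.uIcc (p μ) (q μ) ⊆ (fun z : RPt d => z μ) '' connectedComponentIn (carrier T ∩ B) p := by
    have hpc : IsPreconnected ((fun z : RPt d => z μ) '' connectedComponentIn (carrier T ∩ B) p) :=
      hKpre.image _ (continuous_apply μ).continuousOn
    have ha : p μ ∈ (fun z : RPt d => z μ) '' connectedComponentIn (carrier T ∩ B) p := ⟨p, hpK, rfl⟩
    have hb : q μ ∈ (fun z : RPt d => z μ) '' connectedComponentIn (carrier T ∩ B) p := ⟨q, hqK, rfl⟩
    rcases le_total (p μ) (q μ) with hle | hle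
    · rw [Set.uIcc_of_le hle]; exact hpc.Icc_subset ha hb
    · rw [Set.uIcc_of_ge hle]; exact hpc.Icc_subset hb ha
  have hsub : (fun z : RPt d => z μ) '' connectedComponentIn (carrier T ∩ B) p ⊆ projU μ B T := by
    rintro _ ⟨z, hzK, rfl⟩
    obtain ⟨hzT, hzB⟩ := hKF hzK
    obtain ⟨s, hs, hzs⟩ := mem_carrier.1 hzT
    rw [segment_eq_image_gam] at hzs
    obtain ⟨t, ht, rfl⟩ := hzs
    exact mem_projU.2 ⟨s, hs, t, ⟨ht, hzB⟩, (gam_apply s t μ).symm⟩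
  have h1 : ENNReal.ofReal ρ ≤ volume (Set.uIcc (p μ) (q μ)) := by
    rw [Real.volume_interval]
    exact ENNReal.ofReal_le_ofReal (by rwa [Real.dist_eq, abs_sub_comm] at hμ)
  have h2 : volume (Set.uIcc (p μ) (q μ)) ≤ ENNReal.ofReal (lenIn B T) :=
    (measure_mono (hproj.trans hsub)).trans (volume_projU_le μ B T)
  exact (ENNReal.ofReal_le_ofReal_iff (lenIn_nonneg B T)).1 (h1.trans h2)

/-! ## Part 7. Steiner length ℓ̃ ([Dimock2013BalabanII] App. E), the linear volume bound, the remaining leaves,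
and the scale transfer for `treeLen` with no leaf hypotheses -/

/-- A STEINER-ADMISSIBLE graph for Y: connected and meeting every (closed unit) cube of Y, but NOT required to lie
in the cubes of Y — after [Dimock2013BalabanII] App. E, verbatim: *"In the following ''tree'' means continuum tree.
… M ℓ̃_M(Y) is the length of a minimal tree whose vertices are one point from each block in Y and possibly other
points."* (connected finite unions of segments in place of trees, as for `Admissible`; a tree with a vertex in each
block of Y is Steiner-admissible, so the infimum below is ≤ ℓ̃_M). [cite: Dimock2013BalabanII, App. E (preamble of Lemma E.1)] -/
structure SAdmissible (Y : Finset (Pt d)) (T : List (Seg d)) : Prop where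
  /-- the graph is connected -/
  connected : IsConnected (carrier T)
  /-- the graph intersects all the cubes in Y -/
  meets : ∀ y ∈ Y, (carrier T ∩ cube y).Nonempty

/-- An admissible graph is Steiner-admissible. [folklore] -/
theorem Admissible.sAdmissible {X : Finset (Pt d)} {T : List (Seg d)} (h : Admissible X T) : SAdmissible X T :=
  ⟨h.connected, h.meets⟩

/-- The set of lengths of the Steiner-admissible graphs for Y. [cite: Dimock2013BalabanII, App. E (preamble of Lemma E.1)] -/
def slengths (Y : Finset (Pt d)) : Set ℝ := {ℓ | ∃ T, SAdmissible Y T ∧ len T = ℓ}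

/-- THE STEINER LENGTH ℓ̃(Y) — [Dimock2013BalabanII] App. E, verbatim: *"M ℓ̃_M(Y) is the length of a minimal tree
whose vertices are one point from each block in Y and possibly other points"* — here as the infimum of the lengths of
the Steiner-admissible graphs (M = 1, closed unit cubes, sup metric; junk value 0 for Y = ∅; ≤ the printed ℓ̃_M, cf.
`SAdmissible`). [cite: Dimock2013BalabanII, App. E (preamble of Lemma E.1)] -/
def steinerLen (Y : Finset (Pt d)) : ℝ := sInf (slengths Y)

/-- Members of `slengths Y` are non-negative. [folklore] -/
theorem slengths_nonneg {Y : Finset (Pt d)} {ℓ : ℝ} (h : ℓ ∈ slengths Y) : 0 ≤ ℓ := by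
  obtain ⟨T, -, rfl⟩ := h
  exact len_nonneg T

/-- `slengths Y` is bounded below (by 0). [folklore] -/
theorem bddBelow_slengths (Y : Finset (Pt d)) : BddBelow (slengths Y) :=
  ⟨0, fun _ h => slengths_nonneg h⟩

/-- ℓ̃(Y) ≥ 0. [cite: Dimock2013BalabanII, App. E (preamble of Lemma E.1)] -/
theorem steinerLen_nonneg (Y : Finset (Pt d)) : 0 ≤ steinerLen Y :=
  Real.sInf_nonneg fun _ h => slengths_nonneg h

/-- ℓ̃(Y) is at most the length of any Steiner-admissible graph. [cite: Dimock2013BalabanII, App. E (preamble of Lemma E.1)] -/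
theorem steinerLen_le_len {Y : Finset (Pt d)} {T : List (Seg d)} (h : SAdmissible Y T) : steinerLen Y ≤ len T :=
  csInf_le (bddBelow_slengths Y) ⟨T, h, rfl⟩

/-- A lower bound of the lengths of all Steiner-admissible graphs bounds ℓ̃(Y) from below, provided the class is
non-empty. [folklore] -/
theorem le_steinerLen {Y : Finset (Pt d)} {a : ℝ} (hne : ∃ T, SAdmissible Y T)
    (h : ∀ T, SAdmissible Y T → a ≤ len T) : a ≤ steinerLen Y := by
  obtain ⟨T₀, hT₀⟩ := hne
  refine le_csInf ⟨len T₀, T₀, hT₀, rfl⟩ ?_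
  rintro _ ⟨T, hT, rfl⟩
  exact h T hT

/-- The star graph from the corner of y₀ to the corners of the cubes of a list. [folklore] -/
def star (y₀ : Pt d) (l : List (Pt d)) : List (Seg d) := l.map fun y => (corner y₀, corner y)

/-- The star together with its hub is preconnected. [folklore] -/
theorem isPreconnected_insert_carrier_star (y₀ : Pt d) (l : List (Pt d)) :
    IsPreconnected (insert (corner y₀) (carrier (star y₀ l))) := by
  induction l with
  | nil => simpa [star] using isPreconnected_singleton
  | cons y l ih =>
    have heq : insert (corner y₀) (carrier (star y₀ (y :: l)))
        = segment ℝ (corner y₀) (corner y) ∪ insert (corner y₀) (carrier (star y₀ l)) := by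
      simp only [star, List.map_cons, carrier_cons, Set.union_insert]
    rw [heq]
    exact IsPreconnected.union (corner y₀) (left_mem_segment ℝ _ _) (Set.mem_insert _ _)
      (convex_segment _ _).isPreconnected ih

/-- Every non-empty Y has a Steiner-admissible graph (a star). [folklore] -/
theorem exists_sAdmissible {Y : Finset (Pt d)} (hY : Y.Nonempty) : ∃ T, SAdmissible Y T := by
  obtain ⟨y₀, hy₀⟩ := hY
  have hmem : ∀ y ∈ Y, corner y ∈ carrier (star y₀ Y.toList) := fun y hy =>
    segment_subset_carrier (T := star y₀ Y.toList) (s := (corner y₀, corner y))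
      (List.mem_map.2 ⟨y, Finset.mem_toList.2 hy, rfl⟩) (right_mem_segment ℝ _ _)
  refine ⟨star y₀ Y.toList, ⟨⟨corner y₀, hmem y₀ hy₀⟩, ?_⟩, fun y hy => ⟨corner y, hmem y hy, corner_mem_cube y⟩⟩
  have h := isPreconnected_insert_carrier_star y₀ Y.toList
  rwa [Set.insert_eq_of_mem (hmem y₀ hy₀)] at h

/-- ℓ̃(Y) ≤ d(Y) for localization domains — [Dimock2013BalabanII] App. E, verbatim: *"If Y is connected then ℓ̃_M(Y)
differs slightly from d_M(Y) defined in part I, since the latter requires a minimal tree to lie in Y. But we do have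
ℓ̃_M(Y) ≤ d_M(Y)."* — PROVED (the admissible class is a subclass of the Steiner-admissible class). [cite: Dimock2013BalabanII, App. E (preamble of Lemma E.1)] -/
theorem steinerLen_le_treeLen {Y : Finset (Pt d)} (hY : Y.Nonempty) (hc : FaceConnected Y) :
    steinerLen Y ≤ treeLen Y := by
  obtain ⟨T₀, hT₀, -⟩ := exists_admissible hY hc
  exact le_treeLen ⟨T₀, hT₀⟩ fun T hT => steinerLen_le_len hT.sAdmissible

/-- THE COUNTING STEP, at separation scale ρ ∈ (0, 1/4): if T is Steiner-admissible for Y then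
|Y| ≤ 2^d · max(1, |T|/ρ).  Proof: choose a witness point P_y ∈ T ∩ □_y for each y ∈ Y and a maximal subfamily S
whose witnesses are pairwise > 2ρ apart; every y ∈ Y has its witness within 2ρ of a witness of S, and at most 2^d
cubes have a point within 2ρ < 1/2 of a given point ([Dimock2013BalabanII] App. E, proof of Lemma E.1 (3),
verbatim: *"since at most 2^d blocks be mutually touching"*), so |Y| ≤ 2^d |S|; if |S| ≥ 2 the closed balls
B̄(P_y, ρ), y ∈ S, are pairwise disjoint and each captures length ≥ ρ of T (capture lemma), so |S| ρ ≤ |T|.  (The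
printed proof goes through a path visiting one point per block; the separated-net argument here avoids trees/paths.)
[cite: Dimock2013BalabanII, App. E Lemma E.1(3)] -/
theorem card_le_of_sAdmissible {Y : Finset (Pt d)} {T : List (Seg d)} (hT : SAdmissible Y T)
    {ρ : ℝ} (hρ : 0 < ρ) (hρ4 : ρ < 1 / 4) : (Y.card : ℝ) ≤ 2 ^ d * max 1 (len T / ρ) := by
  classical
  have hw : ∀ y ∈ Y, ∃ z, z ∈ carrier T ∧ z ∈ cube y := fun y hy => by
    obtain ⟨z, hz⟩ := hT.meets y hy
    exact ⟨z, hz.1, hz.2⟩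
  choose! P hPT hPc using hw
  obtain ⟨S, hSmem, hSmax⟩ := (Y.powerset.filter fun S : Finset (Pt d) =>
      ∀ a ∈ S, ∀ b ∈ S, a ≠ b → 2 * ρ < dist (P a) (P b)).exists_max_image Finset.card
    ⟨∅, by simp⟩
  rw [Finset.mem_filter, Finset.mem_powerset] at hSmem
  obtain ⟨hSY, hSsep⟩ := hSmem
  -- covering property of the maximal separated subfamily
  have hcover : ∀ x ∈ Y, ∃ y ∈ S, dist (P x) (P y) ≤ 2 * ρ := by
    intro x hx
    by_cases hxS : x ∈ S
    · exact ⟨x, hxS, by rw [dist_self]; positivity⟩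
    by_contra hfar
    push Not at hfar
    have hins : insert x S ∈ Y.powerset.filter fun S : Finset (Pt d) =>
        ∀ a ∈ S, ∀ b ∈ S, a ≠ b → 2 * ρ < dist (P a) (P b) := by
      rw [Finset.mem_filter, Finset.mem_powerset]
      refine ⟨Finset.insert_subset hx hSY, ?_⟩
      intro a ha b hb hab
      rw [Finset.mem_insert] at ha hb
      rcases ha with rfl | ha <;> rcases hb with rfl | hb
      · exact absurd rfl hab
      · exact hfar b hb
      · rw [dist_comm]; exact hfar a ha
      · exact hSsep a ha b hb hab
    have hle := hSmax _ hins
    rw [Finset.card_insert_of_notMem hxS] at hle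
    omega
  -- at most 2^d cubes have their witness within 2ρ of a given witness
  have hnear : ∀ y ∈ S, ((Y.filter fun x => dist (P x) (P y) ≤ 2 * ρ).card : ℝ) ≤ 2 ^ d := by
    intro y hy
    set m : Fin d → ℤ := fun μ => ⌈(P y) μ - 2 * ρ - 1⌉ with hm
    have hsub : (Y.filter fun x => dist (P x) (P y) ≤ 2 * ρ) ⊆
        Fintype.piFinset fun μ => ({m μ, m μ + 1} : Finset ℤ) := by
      intro x hx
      rw [Finset.mem_filter] at hx
      obtain ⟨hxY, hxd⟩ := hx
      rw [Fintype.mem_piFinset]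
      intro μ
      have hc := (mem_cube.1 (hPc x hxY)) μ
      have hdμ : dist ((P x) μ) ((P y) μ) ≤ 2 * ρ := (dist_le_pi_dist _ _ μ).trans hxd
      rw [Real.dist_eq, abs_le] at hdμ
      have h1 : (P y) μ - 2 * ρ - 1 ≤ (x μ : ℝ) := by linarith [hc.1, hc.2, hdμ.1, hdμ.2]
      have h2 : ((x μ : ℤ) : ℝ) < (m μ : ℝ) + 2 := by
        have := Int.le_ceil ((P y) μ - 2 * ρ - 1)
        linarith [hc.1, hdμ.2]
      have hm1 : m μ ≤ x μ := Int.ceil_le.2 h1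
      have hm2 : x μ < m μ + 2 := by exact_mod_cast h2
      rw [Finset.mem_insert, Finset.mem_singleton]
      omega
    have hbox : (Fintype.piFinset fun μ => ({m μ, m μ + 1} : Finset ℤ)).card = 2 ^ d := by
      rw [Fintype.card_piFinset, Finset.prod_congr rfl (fun μ _ => Finset.card_pair (by omega : m μ ≠ m μ + 1)),
        Finset.prod_const, Finset.card_univ, Fintype.card_fin]
    have := Finset.card_le_card hsub
    rw [hbox] at this
    exact_mod_cast this
  -- hence |Y| ≤ 2^d |S|
  have hYS : (Y.card : ℝ) ≤ 2 ^ d * S.card := by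
    have hcov' : Y ⊆ S.biUnion (fun y => Y.filter fun x => dist (P x) (P y) ≤ 2 * ρ) := by
      intro x hx
      obtain ⟨y, hy, hxy⟩ := hcover x hx
      exact Finset.mem_biUnion.2 ⟨y, hy, Finset.mem_filter.2 ⟨hx, hxy⟩⟩
    calc (Y.card : ℝ) ≤ ((S.biUnion fun y => Y.filter fun x => dist (P x) (P y) ≤ 2 * ρ).card : ℝ) := by
          exact_mod_cast Finset.card_le_card hcov'
      _ ≤ ∑ y ∈ S, ((Y.filter fun x => dist (P x) (P y) ≤ 2 * ρ).card : ℝ) := by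
          exact_mod_cast Finset.card_biUnion_le
      _ ≤ ∑ y ∈ S, (2 : ℝ) ^ d := Finset.sum_le_sum hnear
      _ = 2 ^ d * S.card := by rw [Finset.sum_const, nsmul_eq_mul, mul_comm]
  -- and |S| ≤ max(1, |T|/ρ)
  have hS : (S.card : ℝ) ≤ max 1 (len T / ρ) := by
    rcases Nat.lt_or_ge 1 S.card with h1 | h1
    · have hcap : ∀ y ∈ S, ρ ≤ lenIn (Metric.closedBall (P y) ρ) T := by
        intro y hy
        obtain ⟨y', hy', hne⟩ := (Finset.one_lt_card_iff_nontrivial.1 h1).exists_ne y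
        have hfar : ρ ≤ dist (P y) (P y') := by
          have := hSsep y hy y' hy' hne.symm
          linarith
        exact le_lenIn_closedBall hT.connected.isPreconnected (hPT y (hSY hy)) (hPT y' (hSY hy')) hρ hfar
      have hdisj : (S : Set (Pt d)).PairwiseDisjoint (fun y => Metric.closedBall (P y) ρ) := by
        intro a ha b hb hab
        exact Metric.closedBall_disjoint_closedBall (by have := hSsep a ha b hb hab; linarith)
      have hsum : (S.card : ℝ) * ρ ≤ len T := by
        calc (S.card : ℝ) * ρ = ∑ y ∈ S, ρ := by rw [Finset.sum_const, nsmul_eq_mul]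
          _ ≤ ∑ y ∈ S, lenIn (Metric.closedBall (P y) ρ) T := Finset.sum_le_sum hcap
          _ ≤ len T := sum_lenIn_le_len S _ (fun y _ => Metric.isClosed_closedBall) hdisj T
      calc (S.card : ℝ) ≤ len T / ρ := by rw [le_div_iff₀ hρ]; exact hsum
        _ ≤ max 1 (len T / ρ) := le_max_right _ _
    · calc (S.card : ℝ) ≤ 1 := by exact_mod_cast h1
        _ ≤ max 1 (len T / ρ) := le_max_left _ _
  calc (Y.card : ℝ) ≤ 2 ^ d * S.card := hYS
    _ ≤ 2 ^ d * max 1 (len T / ρ) := mul_le_mul_of_nonneg_left hS (by positivity)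

/-- THE LINEAR VOLUME BOUND FOR A GRAPH: if T is Steiner-admissible for Y then |Y| ≤ 2^d (4|T| + 1)
(the counting step as ρ ↑ 1/4). [cite: Dimock2013BalabanII, App. E Lemma E.1(3)] -/
theorem card_le_of_sAdmissible_len {Y : Finset (Pt d)} {T : List (Seg d)} (hT : SAdmissible Y T) :
    (Y.card : ℝ) ≤ 2 ^ d * (4 * len T + 1) := by
  have hℓ := len_nonneg T
  refine le_of_forall_pos_le_add fun ε hε => ?_
  set ℓ := len T with hℓdef
  set δ : ℝ := ε / (2 ^ d * (ℓ + 1)) with hδ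
  have hδpos : 0 < δ := by positivity
  have hρ : 0 < 1 / (4 + δ) := by positivity
  have hρ4 : 1 / (4 + δ) < 1 / 4 := one_div_lt_one_div_of_lt (by norm_num) (by linarith)
  have hmain := card_le_of_sAdmissible hT hρ hρ4
  have hq : ℓ / (1 / (4 + δ)) = 4 * ℓ + ℓ * δ := by
    field_simp
  have hℓδ : 2 ^ d * (ℓ * δ) ≤ ε := by
    have hℓ1 : ℓ + 1 ≠ 0 := by positivity
    have h1 : 2 ^ d * (ℓ * δ) = ε * (ℓ / (ℓ + 1)) := by
      rw [hδ]
      field_simp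
    have h2 : ℓ / (ℓ + 1) ≤ 1 := by
      rw [div_le_one (by positivity)]
      linarith
    calc 2 ^ d * (ℓ * δ) = ε * (ℓ / (ℓ + 1)) := h1
      _ ≤ ε * 1 := mul_le_mul_of_nonneg_left h2 hε.le
      _ = ε := mul_one ε
  calc (Y.card : ℝ) ≤ 2 ^ d * max 1 (ℓ / (1 / (4 + δ))) := hmain
    _ ≤ 2 ^ d * (1 + ℓ / (1 / (4 + δ))) := by
        gcongr
        exact max_le (le_add_of_nonneg_right (by positivity)) (le_add_of_nonneg_left zero_le_one)
    _ = 2 ^ d * (4 * ℓ + 1) + 2 ^ d * (ℓ * δ) := by rw [hq]; ring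
    _ ≤ 2 ^ d * (4 * ℓ + 1) + ε := by linarith [hℓδ]

/-- THE LINEAR VOLUME BOUND — the analogue of [Dimock2013BalabanII] App. E Lemma E.1 (3), verbatim: *"|Y|_M ≤
4(2^d + 1)(ℓ_M(Y) + 1)"*, here with the (smaller) Steiner length and the constant 2^d·4: |Y| ≤ 2^d (4ℓ̃(Y) + 1) for
every non-empty finite union of unit cubes Y (not necessarily connected). PROVED. [cite: Dimock2013BalabanII, App. E Lemma E.1(3)] -/
theorem card_le_steinerLen {Y : Finset (Pt d)} (hY : Y.Nonempty) :
    (Y.card : ℝ) ≤ 2 ^ d * (4 * steinerLen Y + 1) := by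
  have h2d : (0 : ℝ) < 2 ^ d := by positivity
  have h : (Y.card / 2 ^ d - 1) / 4 ≤ steinerLen Y := by
    refine le_steinerLen (exists_sAdmissible hY) fun T hT => ?_
    have := card_le_of_sAdmissible_len hT
    rw [div_le_iff₀ (by norm_num : (0 : ℝ) < 4), sub_le_iff_le_add, div_le_iff₀ h2d]
    linarith
  rw [div_le_iff₀ (by norm_num : (0 : ℝ) < 4), sub_le_iff_le_add, div_le_iff₀ h2d] at h
  linarith

/-- (2.30) p. 18, LOWER HALF, REPAIRED (cell GAPS.md G-B13-07: the printed "(3·2³)⁻¹M⁻⁴|Y| ≦ d_k(Y)" is false for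
domains of linear size 0): for every localization domain Y, |Y| ≤ 2^d (4 d(Y) + 1) (d = 4: |Y| ≤ 64 d(Y) + 16), i.e.
the additive form N ≤ c (d_k(Y) + 1) with an explicit constant. PROVED. [cite: Balaban1988RG2Cluster, (2.30) p.18 (lower half, repaired form)] -/
theorem card_le_treeLen {Y : Finset (Pt d)} (hY : Y.Nonempty) (hc : FaceConnected Y) :
    (Y.card : ℝ) ≤ 2 ^ d * (4 * treeLen Y + 1) := by
  have h1 := card_le_steinerLen hY
  have h2 := steinerLen_le_treeLen hY hc
  have h2d : (0 : ℝ) ≤ 2 ^ d := by positivity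
  nlinarith

/-- LEAF 3a of `…B13ScaleTransfer` DISCHARGED with ℓ := 2ℓ̃ (the module does not formalise the second length ℓ_M of
[Dimock2013BalabanII] App. E; the pair (2ℓ̃, ℓ̃) satisfies Lemma E.1 (1) "ℓ_M(Y) ≤ 2ℓ̃_M(Y)" trivially and (3) by
`card_le_steinerLen`). [cite: Dimock2013BalabanII, App. E Lemma E.1(1)] -/
theorem steinerLeaf_two_mul : SteinerLeaf d (fun Y => 2 * steinerLen Y) (steinerLen (d := d)) :=
  fun _ _ => le_rfl

/-- LEAF 3b of `…B13ScaleTransfer` DISCHARGED for ℓ := 2ℓ̃: |Y| ≤ 4(2^d + 1)(2ℓ̃(Y) + 1) for every non-empty Y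
(from |Y| ≤ 2^d(4ℓ̃(Y) + 1)). [cite: Dimock2013BalabanII, App. E Lemma E.1(3)] -/
theorem volumeLeaf_two_mul_steinerLen : VolumeLeaf d (fun Y => 2 * steinerLen Y) := by
  intro Y hY
  have h1 := card_le_steinerLen hY
  have h2 : (0 : ℝ) ≤ 2 ^ d * steinerLen Y := mul_nonneg (by positivity) (steinerLen_nonneg Y)
  have h3 : (0 : ℝ) ≤ 2 ^ d := by positivity
  have h4 := steinerLen_nonneg Y
  nlinarith

/-- LEAF 3c of `…B13ScaleTransfer` DISCHARGED: ℓ̃(Y) ≤ d(Y) for localization domains. [cite: Dimock2013BalabanII, App. E (preamble of Lemma E.1)] -/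
theorem insideLeaf_steinerLen : InsideLeaf d (steinerLen (d := d)) (treeLen (d := d)) :=
  fun _ hY hc => steinerLen_le_treeLen hY hc

/-- THE SCALE TRANSFER FOR d_j WITH NO LEAF HYPOTHESES: all five leaves of `…B13ScaleTransfer.scaleTransfer_of_leaves`
are theorems for `treeLen`, hence L · d_{k+1}(Z′) ≤ A_d · d_k(Z) + B_d (A₄ = 10881, B₄ = 5440) for every
localization domain Z, every L — the kernel-checked SUBSTITUTE for [Balaban1988RG2Cluster] (2.36) p. 19 (cell GAPS.md
G-B13-09 / C-pv11-1), now unconditional. [cite: Balaban1988RG2Cluster, (2.36) p.19] -/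
theorem scaleTransfer_treeLen (L : ℕ) : ScaleTransfer d L (treeLen (d := d)) (Acoef d) (Bcoef d) :=
  scaleTransfer_of_leaves (coarseningLeaf_treeLen L) adjoinLeaf_treeLen steinerLeaf_two_mul
    volumeLeaf_two_mul_steinerLen insideLeaf_steinerLen

/-- The same transfer with the sharper constants that the direct chain gives (coarsening → adjoining the collar →
|Z̃ ∖ Z| ≤ (3^d − 1)|Z| → |Z| ≤ 2^d(4d(Z) + 1)): L · d_{k+1}(Z′) ≤ (1 + 4·2^d(3^d − 1)) d_k(Z) + 2^d(3^d − 1).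
[cite: Balaban1988RG2Cluster, (2.36) p.19] -/
theorem scaleTransfer_treeLen_sharp (L : ℕ) :
    ScaleTransfer d L (treeLen (d := d)) (1 + 4 * 2 ^ d * (3 ^ d - 1)) (2 ^ d * (3 ^ d - 1)) := by
  intro Z hZ hc
  have hZc : (collar Z).Nonempty := hZ.mono (subset_collar Z)
  have hcc : FaceConnected (collar Z) := faceConnected_collar hc
  have h1 : (L : ℝ) * treeLen (closureIdx L (collar Z)) ≤ treeLen (collar Z) :=
    mul_treeLen_closureIdx_le L hZc hcc
  have h2 : treeLen (collar Z) ≤ ((collar Z \ Z).card : ℝ) + treeLen Z :=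
    treeLen_le_card_sdiff_add hZ (subset_collar Z) hc hcc
  have h3 : ((collar Z \ Z).card : ℝ) ≤ (3 ^ d - 1) * Z.card := card_collar_sdiff_le Z
  have h4 : (Z.card : ℝ) ≤ 2 ^ d * (4 * treeLen Z + 1) := card_le_treeLen hZ hc
  have h3d : (0 : ℝ) ≤ 3 ^ d - 1 := by
    have : (1 : ℝ) ≤ 3 ^ d := one_le_pow₀ (by norm_num)
    linarith
  have h5 : (3 ^ d - 1 : ℝ) * Z.card ≤ (3 ^ d - 1) * (2 ^ d * (4 * treeLen Z + 1)) :=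
    mul_le_mul_of_nonneg_left h4 h3d
  have expand : treeLen Z + (3 ^ d - 1 : ℝ) * (2 ^ d * (4 * treeLen Z + 1))
      = (1 + 4 * 2 ^ d * (3 ^ d - 1)) * treeLen Z + 2 ^ d * (3 ^ d - 1) := by ring
  linarith

/-- d = 4: L · d_{k+1}(Z′) ≤ 5121 d_k(Z) + 1280 for every localization domain Z ⊂ ℤ⁴ and every L. [cite: Balaban1988RG2Cluster, (2.36) p.19] -/
theorem scaleTransfer_treeLen_four (L : ℕ) : ScaleTransfer 4 L (treeLen (d := 4)) 5121 1280 := by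
  have h := scaleTransfer_treeLen_sharp (d := 4) L
  norm_num at h
  exact h

end

end Literature.MathematicalPhysics.QuantumFieldTheory.Balaban1983to89.TreeLength
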